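import Literature.NumberTheory.Automorphic.WhittakerModelsSupercuspidal
import Literature.NumberTheory.Automorphic.GLnCongruenceSubgroups
import Literature.NumberTheory.Automorphic.LatticeIndexGL
import HarnessLib

/-!
# Twisted projectors along the column groups of `U_n(F)` on a smooth representation of `GL_n(F)`

Topic `NumberTheory/Automorphic`; namespace `Literature.NumberTheory.Automorphic.WhittakerBessel`.
Infrastructure (definitions with bodies and proved theorems only; no named fact, no instance, no
`sorry`) for the proof of Jacquet–Shalika's Cor. (2.5) (`JacquetShalika1981_norm_lt_sqrt_of_isGeneric`
of `SatakeParameterGenericBound`) by Bessel descent along the column groups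
`C_t = {c_t(x) = 1 + ∑_{i<t} x_i E_{i,t}}` of `U_n` (`WhittakerSupercuspidal.colElem`). For a
representation `ρ` of `GL_n(F)`, an additive character `ψ` of conductor `𝒪` and a uniformizer `ϖ`,
the operators
`e^{(t)}_{a',b} v = vol(L_{a'})⁻¹ ∫_{L_{a'}} ψ_b(x)⁻¹ ρ(c_t(x)) v dx`,
`L_{a'} = {x : x_i ∈ ϖ^{a'_i} 𝒪 (i < t)}` a product lattice of `C_t ≅ F^t` and `ψ_b(x) = ψ(b · x)`, are
realised WITHOUT Haar measure as normalised finite averages over `L_{a'} / L_a` for any small lattice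
`L_a` fixing `v` on which `ψ_b` is trivial (`IsAdm`; such exist for smooth `v`, `exists_isAdm`), as in
Bernstein–Zelevinsky 1976, §2.3 and §5.11–5.14, Bump 1997, (4.21) and Prop. 4.4.1 (`n = 2`). They are
the finite Fourier projectors of the `C_t`-module `V` onto the Fourier support `b + L_{a'}^∨`
(l-sheaf picture, Bernstein–Zelevinsky 1976, §1 and §5).

## Contents (all proved)

* Lattice arithmetic: `zBall ϖ k = ϖ^k 𝒪`, the column lattices `colLat ϖ t a`, their index
  `[L_{a'} : L_a] = q^{∑_{i<t}(a_i - a'_i)}` (`natCard_colLat_quotient`, via `colLatResidue` and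
  `natCard_quotient_span_pow` of `LatticeIndexGL`), the characters `cpair ψ b x = ψ(b · x)`, their
  **duality** with the lattices for `ψ` of conductor `𝒪` (`cpair_eq_one_of_mem`,
  `mem_zBall_of_cpair_eq_one`) and the **orthogonality relations** over `L_{a'}/L_a`
  (`sum_cpair_out_eq_card`, `sum_cpair_out_eq_zero`).
* Shapes and integrality: `ψ_U(c_t(x)) = ψ(x_{t-1})`, conjugation of `c_t(x)` by top-left `diag(g₀,1)`
  and by the torus `ϖ^c`, row shears (`WhittakerSupercuspidal.rowShear`), membership of integral
  column elements and row shears in `GL_n(𝒪)` and in the congruence subgroups `congruenceGL n γ`,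
  smallness (`exists_valuation_zpow_le`, `exists_colLat_colElem_mem`, `exists_rowShear_mem`).
* Twisted sums `twSum` over `L_{a'}/L_a` (a `finsum`), independence of the representatives
  (`summand_eq_of_mk_eq`, `twSum_eq_sum_of_bijective`), equivariance (`twSum_apply_colElem`,
  `apply_colElem_twSum`), independence of the small lattice (`card_smul_twSum_eq`), the normalised
  averages `twAvg` and the canonical projector `proj` (`proj_eq_twAvg`), linearity;
* the algebra of projectors: equivariant vectors (`proj_of_equivariant_eq_self/zero`), **composition**
  `e_{a₁',b₁} e_{a₂',b₂} = e_{a₂',b₂}` or `0` for nested/disjoint Fourier supports (`proj_proj_eq_self`,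
  `proj_proj_eq_zero`, `proj_idem`, `proj_comm`), the **refinement** `e_{a',b} = ∑_{c ∈ L_{a'}^∨/L_{a''}^∨} e_{a'',b+c}`
  (`proj_eq_sum_proj`, finite Fourier inversion), **transport of structure** under the torus
  (`apply_zpowDiagGL_proj`) and under `GL_t(𝒪)` (`apply_glInt_proj`), **self-adjointness** for invariant
  sesquilinear forms (`form_proj_left_eq_right`) and transparency for Whittaker functionals
  (`whittaker_proj`: `Λ(e_{a',e_{t-1}} v) = Λ v`).

## References

* I. N. Bernstein, A. V. Zelevinsky, *Representations of the group `GL(n, F)` where `F` is a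
  non-archimedean local field*, Russian Math. Surveys 31:3 (1976), 1–68, §1, §2.3, §5
  [BernsteinZelevinsky1976].
* D. Bump, *Automorphic Forms and Representations* (1997), §4.4 (Prop. 4.4.1, (4.21)) and
  Exercise 3.1.1 [Bump1997].
* H. Jacquet, J. A. Shalika, *On Euler products and the classification of automorphic
  representations I*, Amer. J. Math. 103 (1981), §1–2, Cor. (2.5) [JacquetShalikaAJM1981].
-/

noncomputable section

open scoped MatrixGroups
open ValuativeRel Matrix Finset

namespace Literature.NumberTheory.Automorphic

namespace WhittakerBessel

/-! ### Balls `ϖ^k 𝒪` and product lattices supported in the rows `< r` -/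

section Lattices

variable {F : Type*} [Field F] [ValuativeRel F] {n : ℕ}

/-- The fractional ideal `ϖ^k 𝒪 = {x : |x| ≤ |ϖ^k|}` as an additive subgroup of `F` (`k ∈ ℤ`).
[folklore] -/
def zBall (ϖ : F) (k : ℤ) : AddSubgroup F where
  carrier := {x | valuation F x ≤ valuation F (ϖ ^ k)}
  zero_mem' := by simp
  add_mem' {x y} hx hy := by
    simp only [Set.mem_setOf_eq] at hx hy ⊢
    exact Valuation.map_add_le _ hx hy
  neg_mem' {x} hx := by
    simp only [Set.mem_setOf_eq] at hx ⊢
    rwa [Valuation.map_neg]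

omit [ValuativeRel F] in
/-- `ϖ^k ≠ 0` for `ϖ ≠ 0`. [folklore] -/
theorem zpow_ne_zero_of_ne_zero {ϖ : F} (hϖ : ϖ ≠ 0) (k : ℤ) : ϖ ^ k ≠ 0 := zpow_ne_zero k hϖ

/-- Membership in `ϖ^k 𝒪`. [folklore] -/
@[simp] theorem mem_zBall_iff {ϖ : F} {k : ℤ} {x : F} :
    x ∈ zBall ϖ k ↔ valuation F x ≤ valuation F (ϖ ^ k) := Iff.rfl

/-- `ϖ^k ∈ ϖ^k 𝒪`. [folklore] -/
theorem zpow_mem_zBall (ϖ : F) (k : ℤ) : ϖ ^ k ∈ zBall ϖ k := mem_zBall_iff.2 le_rfl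

/-- `|ϖ^{k'}| ≤ |ϖ^k|` for `k ≤ k'` when `|ϖ| ≤ 1`. [folklore] -/
theorem valuation_zpow_le_of_le {ϖ : F} (hϖ0 : ϖ ≠ 0) (hϖ : valuation F ϖ ≤ 1) {k k' : ℤ}
    (h : k ≤ k') : valuation F (ϖ ^ k') ≤ valuation F (ϖ ^ k) := by
  obtain ⟨d, rfl⟩ := Int.exists_add_of_le h
  rw [zpow_add₀ hϖ0, zpow_natCast, map_mul, map_pow]
  exact mul_le_of_le_one_right' (pow_le_one' hϖ d)

/-- The balls decrease as the exponent increases. [folklore] -/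
theorem zBall_anti {ϖ : F} (hϖ0 : ϖ ≠ 0) (hϖ : valuation F ϖ ≤ 1) {k k' : ℤ} (h : k ≤ k') :
    zBall ϖ k' ≤ zBall ϖ k := fun _ hx =>
  mem_zBall_iff.2 ((mem_zBall_iff.1 hx).trans (valuation_zpow_le_of_le hϖ0 hϖ h))

/-- `ϖ^c · ϖ^k 𝒪 = ϖ^{c+k} 𝒪`: scaling a ball. [folklore] -/
theorem zpow_mul_mem_zBall_iff {ϖ : F} (hϖ0 : ϖ ≠ 0) (c k : ℤ) (x : F) :
    ϖ ^ c * x ∈ zBall ϖ (c + k) ↔ x ∈ zBall ϖ k := by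
  rw [mem_zBall_iff, mem_zBall_iff, zpow_add₀ hϖ0, map_mul, map_mul]
  have h0 : valuation F (ϖ ^ c) ≠ 0 := by
    rw [ne_eq, map_eq_zero]; exact zpow_ne_zero c hϖ0
  rw [mul_le_mul_iff_right₀ (zero_lt_iff.2 h0)]

/-- The **column lattice** `L_a^{(r)} = {x : x_i ∈ ϖ^{a_i} 𝒪 (i < r), x_i = 0 (i ≥ r)}` of the column
group of index `r`, as an additive subgroup of `Fin n → F`. [folklore] -/
def colLat (ϖ : F) (r : Fin n) (a : Fin n → ℤ) : AddSubgroup (Fin n → F) where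
  carrier := {x | (∀ i, i < r → x i ∈ zBall ϖ (a i)) ∧ ∀ i, ¬ i < r → x i = 0}
  zero_mem' := ⟨fun i _ => AddSubgroup.zero_mem _, fun i _ => rfl⟩
  add_mem' {x y} hx hy :=
    ⟨fun i hi => AddSubgroup.add_mem _ (hx.1 i hi) (hy.1 i hi), fun i hi => by
      rw [Pi.add_apply, hx.2 i hi, hy.2 i hi, add_zero]⟩
  neg_mem' {x} hx := ⟨fun i hi => AddSubgroup.neg_mem _ (hx.1 i hi), fun i hi => by
      rw [Pi.neg_apply, hx.2 i hi, neg_zero]⟩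

/-- Membership in a column lattice. [folklore] -/
theorem mem_colLat_iff {ϖ : F} {r : Fin n} {a : Fin n → ℤ} {x : Fin n → F} :
    x ∈ colLat ϖ r a ↔ (∀ i, i < r → x i ∈ zBall ϖ (a i)) ∧ ∀ i, ¬ i < r → x i = 0 := Iff.rfl

/-- The column lattice only depends on the exponents in the rows `< r`. [folklore] -/
theorem colLat_congr {ϖ : F} {r : Fin n} {a a' : Fin n → ℤ} (h : ∀ i, i < r → a i = a' i) :
    colLat ϖ r a = colLat ϖ r a' := by
  ext x
  simp only [mem_colLat_iff]
  refine and_congr_left fun _ => forall₂_congr fun i hi => ?_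
  rw [h i hi]

/-- Monotonicity: `a' ≤ a` on the rows `< r` gives `L_a ≤ L_{a'}`. [folklore] -/
theorem colLat_mono {ϖ : F} (hϖ0 : ϖ ≠ 0) (hϖ : valuation F ϖ ≤ 1) {r : Fin n} {a a' : Fin n → ℤ}
    (h : ∀ i, i < r → a' i ≤ a i) : colLat ϖ r a ≤ colLat ϖ r a' := fun _ hx =>
  ⟨fun i hi => zBall_anti hϖ0 hϖ (h i hi) (hx.1 i hi), hx.2⟩

/-- Membership of the truncation `x̃` (`WhittakerSupercuspidal.trunc`) in a column lattice. [folklore] -/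
theorem trunc_mem_colLat_iff {ϖ : F} {r : Fin n} {a : Fin n → ℤ} {x : Fin n → F} :
    WhittakerSupercuspidal.trunc r x ∈ colLat ϖ r a ↔ ∀ i, i < r → x i ∈ zBall ϖ (a i) := by
  simp only [mem_colLat_iff, WhittakerSupercuspidal.trunc_apply]
  constructor
  · rintro ⟨h, -⟩ i hi
    simpa [hi] using h i hi
  · intro h
    exact ⟨fun i hi => by simpa [hi] using h i hi, fun i hi => by simp [hi]⟩

/-- An element of a column lattice is its own truncation. [folklore] -/
theorem trunc_eq_self_of_mem_colLat {ϖ : F} {r : Fin n} {a : Fin n → ℤ} {x : Fin n → F}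
    (hx : x ∈ colLat ϖ r a) : WhittakerSupercuspidal.trunc r x = x := by
  funext i
  rw [WhittakerSupercuspidal.trunc_apply]
  split_ifs with hi
  · rfl
  · exact (hx.2 i hi).symm

/-- Scaling by a diagonal `ϖ`-power: `(ϖ^{c_i} x_i)_i ∈ L_{c + a}` iff `x ∈ L_a`. [folklore] -/
theorem smul_mem_colLat_iff {ϖ : F} (hϖ0 : ϖ ≠ 0) {r : Fin n} (c a : Fin n → ℤ) (x : Fin n → F) :
    (fun i => ϖ ^ c i * x i) ∈ colLat ϖ r (c + a) ↔ x ∈ colLat ϖ r a := by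
  simp only [mem_colLat_iff, Pi.add_apply, zpow_mul_mem_zBall_iff hϖ0, mul_eq_zero,
    zpow_ne_zero _ hϖ0, false_or]

end Lattices

/-! ### Divisibility by powers of `ϖ` in `𝒪` and the index of nested column lattices -/

section Index

variable {F : Type*} [Field F] [ValuativeRel F] {n : ℕ} {ϖ : F}

/-- `v(x) ≤ v(ϖ^d)` iff `x = ϖ^d z` with `z` integral (`ϖ ≠ 0`). [folklore] -/
theorem valuation_le_zpow_iff (hϖ0 : ϖ ≠ 0) (d : ℤ) (x : F) :
    valuation F x ≤ valuation F (ϖ ^ d) ↔ ϖ ^ (-d) * x ∈ 𝒪[F] := by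
  rw [Valuation.mem_integer_iff, map_mul, _root_.zpow_neg, map_inv₀]
  have h0 : valuation F (ϖ ^ d) ≠ 0 := by rw [ne_eq, map_eq_zero]; exact zpow_ne_zero d hϖ0
  rw [inv_mul_le_iff₀ (zero_lt_iff.2 h0), mul_one]

/-- In `𝒪`, `ϖ^d ∣ y` iff `v(y) ≤ v(ϖ^d)`. [folklore] -/
theorem pow_dvd_iff_valuation_le (hϖ : IsUniformizingElement ϖ) (d : ℕ) (y : 𝒪[F]) :
    (⟨ϖ, hϖ.mem⟩ : 𝒪[F]) ^ d ∣ y ↔ valuation F (y : F) ≤ valuation F (ϖ ^ (d : ℤ)) := by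
  constructor
  · rintro ⟨z, hz⟩
    have : (y : F) = ϖ ^ d * z := by
      have := congrArg Subtype.val hz
      simpa using this
    rw [this, zpow_natCast, map_mul]
    exact mul_le_of_le_one_right' ((Valuation.mem_integer_iff _ _).1 z.2)
  · intro h
    rw [valuation_le_zpow_iff hϖ.ne_zero] at h
    refine ⟨⟨ϖ ^ (-(d : ℤ)) * y, h⟩, Subtype.ext ?_⟩
    simp only [Subring.coe_mul, SubmonoidClass.coe_pow]
    rw [← mul_assoc, ← zpow_natCast, ← zpow_add₀ hϖ.ne_zero, add_neg_cancel, zpow_zero, one_mul]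

variable (ϖ) in
/-- The coordinate map `x ↦ (ϖ^{-a'_i} x_i mod ϖ^{d_i})_{i<r}` on `L_{a'}`, `d_i = a_i - a'_i ≥ 0`.
[folklore] -/
def colLatResidue (hϖ : IsUniformizingElement ϖ) (r : Fin n) (a a' : Fin n → ℤ) :
    colLat ϖ r a' →+
      ((i : {i : Fin n // i < r}) → 𝒪[F] ⧸ Ideal.span {(⟨ϖ, hϖ.mem⟩ : 𝒪[F]) ^ (a i - a' i).toNat}) :=
  AddMonoidHom.mk'
    (fun x i => Ideal.Quotient.mk _
      ⟨ϖ ^ (-a' i) * (x : Fin n → F) i,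
        (valuation_le_zpow_iff hϖ.ne_zero (a' i) _).1 (mem_zBall_iff.1 (x.2.1 i i.2))⟩)
    (fun x y => by
      funext i
      rw [Pi.add_apply, ← map_add]
      congr 1
      exact Subtype.ext (by simp [mul_add]))

/-- Unfolding of `colLatResidue`. [folklore] -/
theorem colLatResidue_apply (hϖ : IsUniformizingElement ϖ) (r : Fin n) (a a' : Fin n → ℤ)
    (x : colLat ϖ r a') (i : {i : Fin n // i < r}) :
    colLatResidue ϖ hϖ r a a' x i = Ideal.Quotient.mk _
      ⟨ϖ ^ (-a' i) * (x : Fin n → F) i,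
        (valuation_le_zpow_iff hϖ.ne_zero (a' i) _).1 (mem_zBall_iff.1 (x.2.1 i i.2))⟩ := rfl

/-- The coordinate residue map is onto. [folklore] -/
theorem colLatResidue_surjective (hϖ : IsUniformizingElement ϖ) (r : Fin n) (a a' : Fin n → ℤ) :
    Function.Surjective (colLatResidue ϖ hϖ r a a') := by
  classical
  intro y
  choose z hz using fun i => Ideal.Quotient.mk_surjective (y i)
  -- the preimage `x_i = ϖ^{a'_i} z_i` for `i < r`, `0` otherwise
  set x : Fin n → F := fun i => if h : i < r then ϖ ^ (a' i) * (z ⟨i, h⟩ : F) else 0 with hx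
  have hxmem : x ∈ colLat ϖ r a' := by
    refine ⟨fun i hi => ?_, fun i hi => by simp [hx, hi]⟩
    rw [hx]; dsimp only; rw [dif_pos hi, mem_zBall_iff, map_mul]
    exact mul_le_of_le_one_right' ((Valuation.mem_integer_iff _ _).1 (z ⟨i, hi⟩).2)
  refine ⟨⟨x, hxmem⟩, funext fun i => ?_⟩
  rw [colLatResidue_apply, ← hz i]
  congr 1
  refine Subtype.ext ?_
  simp only [hx, dif_pos i.2]
  rw [← mul_assoc, ← zpow_add₀ hϖ.ne_zero, neg_add_cancel, zpow_zero, one_mul]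

/-- The kernel of the coordinate residue map is `L_a`. [folklore] -/
theorem ker_colLatResidue (hϖ : IsUniformizingElement ϖ) (r : Fin n) {a a' : Fin n → ℤ}
    (h : ∀ i, i < r → a' i ≤ a i) :
    (colLatResidue ϖ hϖ r a a').ker = (colLat ϖ r a).addSubgroupOf (colLat ϖ r a') := by
  ext x
  rw [AddMonoidHom.mem_ker, AddSubgroup.mem_addSubgroupOf, mem_colLat_iff, funext_iff]
  simp only [Pi.zero_apply, colLatResidue_apply, Ideal.Quotient.eq_zero_iff_mem,
    Ideal.mem_span_singleton, pow_dvd_iff_valuation_le hϖ]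
  constructor
  · intro hx
    refine ⟨fun i hi => ?_, x.2.2⟩
    have := hx ⟨i, hi⟩
    rw [Int.toNat_of_nonneg (sub_nonneg.2 (h i hi)), ← mem_zBall_iff,
      show a i - a' i = -a' i + a i by ring, zpow_mul_mem_zBall_iff hϖ.ne_zero] at this
    exact this
  · rintro ⟨hx, -⟩ ⟨i, hi⟩
    rw [Int.toNat_of_nonneg (sub_nonneg.2 (h i hi)), ← mem_zBall_iff,
      show a i - a' i = -a' i + a i by ring, zpow_mul_mem_zBall_iff hϖ.ne_zero]
    exact hx i hi

/-- **Index of nested column lattices**: for `a' ≤ a` on the rows `< r`,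
`[L_{a'} : L_a] = q^{∑_{i<r} (a_i - a'_i)}`. [folklore] -/
theorem natCard_colLat_quotient [Finite 𝓀[F]] (hϖ : IsUniformizingElement ϖ) (r : Fin n)
    {a a' : Fin n → ℤ} (h : ∀ i, i < r → a' i ≤ a i) :
    Nat.card (colLat ϖ r a' ⧸ (colLat ϖ r a).addSubgroupOf (colLat ϖ r a')) =
      Nat.card 𝓀[F] ^ ∑ i : {i : Fin n // i < r}, (a i - a' i).toNat := by
  rw [← ker_colLatResidue hϖ r h,
    Nat.card_congr (QuotientAddGroup.quotientKerEquivOfSurjective _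
      (colLatResidue_surjective hϖ r a a')).toEquiv, Nat.card_pi, ← Finset.prod_pow_eq_pow_sum]
  exact Finset.prod_congr rfl fun i _ => natCard_quotient_span_pow hϖ _

/-- The quotients of nested column lattices are finite. [folklore] -/
theorem finite_colLat_quotient [Finite 𝓀[F]] (hϖ : IsUniformizingElement ϖ) (r : Fin n)
    {a a' : Fin n → ℤ} (h : ∀ i, i < r → a' i ≤ a i) :
    Finite (colLat ϖ r a' ⧸ (colLat ϖ r a).addSubgroupOf (colLat ϖ r a')) := by
  refine Nat.finite_of_card_ne_zero ?_
  rw [natCard_colLat_quotient hϖ r h]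
  exact pow_ne_zero _ (Nat.card_pos (α := 𝓀[F])).ne'

end Index

/-! ### The characters `ψ_b(x) = ψ(b · x)` of the column group and their duality with the lattices -/

section Fourier

variable {F : Type*} [Field F] [ValuativeRel F] {n : ℕ} {ϖ : F} (ψ : AddChar F Circle)

/-- `ψ_b(x) = ψ(∑_i b_i x_i)` as a complex number of modulus one. [folklore] -/
def cpair (b x : Fin n → F) : ℂ := ((ψ (b ⬝ᵥ x) : Circle) : ℂ)

omit [ValuativeRel F] in
/-- Unfolding of `cpair`. [folklore] -/
theorem cpair_apply (b x : Fin n → F) : cpair ψ b x = ((ψ (b ⬝ᵥ x) : Circle) : ℂ) := rfl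

omit [ValuativeRel F] in
/-- `ψ_b` is a character of the column group. [folklore] -/
theorem cpair_add_right (b x y : Fin n → F) : cpair ψ b (x + y) = cpair ψ b x * cpair ψ b y := by
  rw [cpair, cpair, cpair, dotProduct_add, AddChar.map_add_eq_mul, Circle.coe_mul]

omit [ValuativeRel F] in
/-- `b ↦ ψ_b(x)` is a character. [folklore] -/
theorem cpair_add_left (b b' x : Fin n → F) : cpair ψ (b + b') x = cpair ψ b x * cpair ψ b' x := by
  rw [cpair, cpair, cpair, add_dotProduct, AddChar.map_add_eq_mul, Circle.coe_mul]

omit [ValuativeRel F] in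
/-- `ψ_b(0) = 1`. [folklore] -/
@[simp] theorem cpair_zero_right (b : Fin n → F) : cpair ψ b 0 = 1 := by
  rw [cpair, dotProduct_zero, AddChar.map_zero_eq_one, Circle.coe_one]

omit [ValuativeRel F] in
/-- `ψ_0(x) = 1`. [folklore] -/
@[simp] theorem cpair_zero_left (x : Fin n → F) : cpair ψ 0 x = 1 := by
  rw [cpair, zero_dotProduct, AddChar.map_zero_eq_one, Circle.coe_one]

omit [ValuativeRel F] in
/-- `ψ_b(x) ≠ 0`. [folklore] -/
theorem cpair_ne_zero (b x : Fin n → F) : cpair ψ b x ≠ 0 := Circle.coe_ne_zero _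

omit [ValuativeRel F] in
/-- `|ψ_b(x)| = 1`. [folklore] -/
theorem norm_cpair (b x : Fin n → F) : ‖cpair ψ b x‖ = 1 := Circle.norm_coe _

omit [ValuativeRel F] in
/-- `ψ_b(-x) ψ_b(x) = 1`. [folklore] -/
theorem cpair_neg_right_mul (b x : Fin n → F) : cpair ψ b (-x) * cpair ψ b x = 1 := by
  rw [← cpair_add_right, neg_add_cancel, cpair_zero_right]

omit [ValuativeRel F] in
/-- `ψ_b(-x) = ψ_b(x)⁻¹`. [folklore] -/
theorem cpair_neg_right (b x : Fin n → F) : cpair ψ b (-x) = (cpair ψ b x)⁻¹ :=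
  eq_inv_of_mul_eq_one_left (cpair_neg_right_mul ψ b x)

omit [ValuativeRel F] in
/-- `ψ_{-b}(x) = ψ_b(x)⁻¹`. [folklore] -/
theorem cpair_neg_left (b x : Fin n → F) : cpair ψ (-b) x = (cpair ψ b x)⁻¹ := by
  refine eq_inv_of_mul_eq_one_left ?_
  rw [← cpair_add_left, neg_add_cancel, cpair_zero_left]

omit [ValuativeRel F] in
/-- `conj ψ_b(x) = ψ_b(-x)`. [folklore] -/
theorem conj_cpair (b x : Fin n → F) : (starRingEnd ℂ) (cpair ψ b x) = cpair ψ b (-x) := by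
  rw [cpair_neg_right, cpair, ← Circle.coe_inv, Circle.coe_inv_eq_conj]

omit [ValuativeRel F] in
/-- Moving a scalar across the pairing: `ψ_b(x)` with `x_i = t_i y_i` equals `ψ_{b'}(y)` with
`b'_i = b_i t_i`. [folklore] -/
theorem cpair_mul_eq (b t y : Fin n → F) :
    cpair ψ b (fun i => t i * y i) = cpair ψ (fun i => b i * t i) y := by
  simp only [cpair, dotProduct, mul_assoc]

omit [ValuativeRel F] in
/-- `ψ_b(g x) = ψ_{b g}(x)`. [folklore] -/
theorem cpair_mulVec (b : Fin n → F) (M : Matrix (Fin n) (Fin n) F) (x : Fin n → F) :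
    cpair ψ b (M *ᵥ x) = cpair ψ (b ᵥ* M) x := by
  rw [cpair, cpair, dotProduct_mulVec]

/-- **`ψ_b` is trivial on `L_a` when `b_i ∈ ϖ^{-a_i} 𝒪` for `i < r`** (`ψ` trivial on `𝒪`).
[folklore] -/
theorem cpair_eq_one_of_mem (hψ : ∀ c ∈ 𝒪[F], ψ c = 1) (hϖ0 : ϖ ≠ 0) {r : Fin n} {a : Fin n → ℤ}
    {b x : Fin n → F} (hb : ∀ i, i < r → b i ∈ zBall ϖ (-a i)) (hx : x ∈ colLat ϖ r a) :
    cpair ψ b x = 1 := by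
  rw [cpair, hψ _ ?_, Circle.coe_one]
  rw [dotProduct]
  refine Subring.sum_mem _ fun i _ => ?_
  by_cases hi : i < r
  · rw [Valuation.mem_integer_iff, map_mul]
    have h1 := mem_zBall_iff.1 (hb i hi)
    have h2 := mem_zBall_iff.1 (hx.1 i hi)
    calc valuation F (b i) * valuation F (x i)
        ≤ valuation F (ϖ ^ (-a i)) * valuation F (ϖ ^ a i) := mul_le_mul' h1 h2
      _ = 1 := by rw [← map_mul, ← zpow_add₀ hϖ0, neg_add_cancel, zpow_zero, map_one]
  · rw [hx.2 i hi, mul_zero]; exact Subring.zero_mem _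

/-- **Duality**: if `ψ_b` is trivial on `L_a` then `b_i ∈ ϖ^{-a_i} 𝒪` for all `i < r` (`ψ` of
conductor exactly `𝒪`: non-trivial on `ϖ⁻¹ 𝒪`). [folklore] -/
theorem mem_zBall_of_cpair_eq_one (hϖ : IsUniformizingElement ϖ)
    (hψ' : ∃ c ∈ 𝒪[F], ψ (ϖ⁻¹ * c) ≠ 1) {r : Fin n} {a : Fin n → ℤ} {b : Fin n → F}
    (h : ∀ x ∈ colLat ϖ r a, cpair ψ b x = 1) {i : Fin n} (hi : i < r) :
    b i ∈ zBall ϖ (-a i) := by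
  by_contra hbi
  rw [mem_zBall_iff, not_le] at hbi
  obtain ⟨c₀, hc₀, hne⟩ := hψ'
  -- `u = b_i ϖ^{a_i}` has `|u| > 1`, so `u⁻¹ = ϖ w` with `w` integral
  set u : F := b i * ϖ ^ a i with hu
  have hu1 : 1 < valuation F u := by
    have h0 : valuation F (ϖ ^ a i) ≠ 0 := by
      rw [ne_eq, map_eq_zero]; exact zpow_ne_zero _ hϖ.ne_zero
    have := mul_lt_mul_of_pos_right hbi (zero_lt_iff.2 h0)
    rwa [← map_mul, ← map_mul, ← zpow_add₀ hϖ.ne_zero, neg_add_cancel, zpow_zero, map_one] at this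
  have hu0 : u ≠ 0 := by
    rintro h0; rw [h0, map_zero] at hu1; exact not_lt_zero hu1
  have huinv : valuation F u⁻¹ < 1 := by rw [map_inv₀]; exact inv_lt_one_of_one_lt₀ hu1
  obtain ⟨w, hw, hw'⟩ := hϖ.exists_eq_mul ((Valuation.mem_integer_iff _ _).2 huinv.le) huinv
  have huw : u * w = ϖ⁻¹ := by
    have : w = ϖ⁻¹ * u⁻¹ := by
      rw [eq_inv_mul_iff_mul_eq₀ hϖ.ne_zero, ← hw']
    rw [this, mul_comm ϖ⁻¹ u⁻¹, mul_inv_cancel_left₀ hu0]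
  -- the test vector
  set x : Fin n → F := Pi.single i (ϖ ^ a i * (c₀ * w)) with hx
  have hxmem : x ∈ colLat ϖ r a := by
    refine ⟨fun j hj => ?_, fun j hj => ?_⟩
    · by_cases hji : j = i
      · subst hji
        rw [hx, Pi.single_eq_same, mem_zBall_iff, map_mul]
        exact mul_le_of_le_one_right' ((Valuation.mem_integer_iff _ _).1 (Subring.mul_mem _ hc₀ hw))
      · rw [hx, Pi.single_eq_of_ne hji]; exact AddSubgroup.zero_mem _
    · have hji : j ≠ i := fun e => hj (e ▸ hi)
      rw [hx, Pi.single_eq_of_ne hji]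
  have := h x hxmem
  rw [cpair, hx, dotProduct_single, ← mul_assoc, ← hu, mul_left_comm, huw, mul_comm,
    ← Circle.coe_one, Subtype.coe_inj] at this
  exact hne this

/-- Duality, contrapositive form: if `b_i ∉ ϖ^{-a_i} 𝒪` for some `i < r`, `ψ_b` is non-trivial on
`L_a`. [folklore] -/
theorem exists_cpair_ne_one (hϖ : IsUniformizingElement ϖ) (hψ' : ∃ c ∈ 𝒪[F], ψ (ϖ⁻¹ * c) ≠ 1)
    {r : Fin n} {a : Fin n → ℤ} {b : Fin n → F} (hb : ¬ ∀ i, i < r → b i ∈ zBall ϖ (-a i)) :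
    ∃ x ∈ colLat ϖ r a, cpair ψ b x ≠ 1 := by
  by_contra h
  push Not at h
  exact hb fun i hi => mem_zBall_of_cpair_eq_one ψ hϖ hψ' h hi

/-! #### Character sums over `L_{a'} / L_a` -/

/-- Representatives of a coset of `L_a` in `L_{a'}` differ by elements of `L_a`: for
`q = [z]`, `ψ_c(q̃) = ψ_c(z)` as soon as `ψ_c` is trivial on `L_a`. [folklore] -/
theorem cpair_out_eq (hψ : ∀ c ∈ 𝒪[F], ψ c = 1) (hϖ0 : ϖ ≠ 0) {r : Fin n} {a a' : Fin n → ℤ}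
    {c : Fin n → F} (hc : ∀ i, i < r → c i ∈ zBall ϖ (-a i)) (z : colLat ϖ r a')
    (q : colLat ϖ r a' ⧸ (colLat ϖ r a).addSubgroupOf (colLat ϖ r a'))
    (hq : (z : colLat ϖ r a' ⧸ (colLat ϖ r a).addSubgroupOf (colLat ϖ r a')) = q) :
    cpair ψ c ((q.out : colLat ϖ r a') : Fin n → F) = cpair ψ c (z : Fin n → F) := by
  have hmem : -(z : Fin n → F) + ((q.out : colLat ϖ r a') : Fin n → F) ∈ colLat ϖ r a := by
    have : (QuotientAddGroup.mk z : colLat ϖ r a' ⧸ (colLat ϖ r a).addSubgroupOf (colLat ϖ r a')) =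
        QuotientAddGroup.mk q.out := by rw [QuotientAddGroup.out_eq']; exact hq
    have := QuotientAddGroup.eq.1 this
    rw [AddSubgroup.mem_addSubgroupOf] at this
    simpa using this
  have key : ((q.out : colLat ϖ r a') : Fin n → F) = (z : Fin n → F) + (-(z : Fin n → F) + q.out) := by
    abel
  rw [key, cpair_add_right, cpair_eq_one_of_mem ψ hψ hϖ0 hc hmem, mul_one]

/-- **Orthogonality of characters, trivial case**: if `ψ_c` is trivial on `L_{a'}`, the character
sum over `L_{a'}/L_a` is the number of cosets. [folklore] -/
theorem sum_cpair_out_eq_card (hψ : ∀ c ∈ 𝒪[F], ψ c = 1) (hϖ0 : ϖ ≠ 0) {r : Fin n}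
    {a a' : Fin n → ℤ} {c : Fin n → F} (hc : ∀ i, i < r → c i ∈ zBall ϖ (-a' i))
    [Fintype (colLat ϖ r a' ⧸ (colLat ϖ r a).addSubgroupOf (colLat ϖ r a'))] :
    ∑ q : colLat ϖ r a' ⧸ (colLat ϖ r a).addSubgroupOf (colLat ϖ r a'),
        cpair ψ c ((q.out : colLat ϖ r a') : Fin n → F) =
      Fintype.card (colLat ϖ r a' ⧸ (colLat ϖ r a).addSubgroupOf (colLat ϖ r a')) := by
  rw [Finset.sum_congr rfl fun q _ => cpair_eq_one_of_mem ψ hψ hϖ0 hc (q.out).2, Finset.sum_const,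
    Finset.card_univ, nsmul_eq_mul, mul_one]

/-- **Orthogonality of characters, non-trivial case**: if `ψ_c` is trivial on `L_a` but not on
`L_{a'}`, the character sum over `L_{a'}/L_a` vanishes (translate by `y ∈ L_{a'}` with
`ψ_c(y) ≠ 1`). [folklore] -/
theorem sum_cpair_out_eq_zero (hϖ : IsUniformizingElement ϖ) (hψ : ∀ c ∈ 𝒪[F], ψ c = 1)
    (hψ' : ∃ c ∈ 𝒪[F], ψ (ϖ⁻¹ * c) ≠ 1) {r : Fin n} {a a' : Fin n → ℤ} {c : Fin n → F}
    (hc : ∀ i, i < r → c i ∈ zBall ϖ (-a i)) (hc' : ¬ ∀ i, i < r → c i ∈ zBall ϖ (-a' i))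
    [Fintype (colLat ϖ r a' ⧸ (colLat ϖ r a).addSubgroupOf (colLat ϖ r a'))] :
    ∑ q : colLat ϖ r a' ⧸ (colLat ϖ r a).addSubgroupOf (colLat ϖ r a'),
        cpair ψ c ((q.out : colLat ϖ r a') : Fin n → F) = 0 := by
  obtain ⟨y, hy, hne⟩ := exists_cpair_ne_one ψ hϖ hψ' hc'
  -- translate the summation by `[y]`
  have key : (∑ q : colLat ϖ r a' ⧸ (colLat ϖ r a).addSubgroupOf (colLat ϖ r a'),
        cpair ψ c ((q.out : colLat ϖ r a') : Fin n → F)) =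
      cpair ψ c y * ∑ q : colLat ϖ r a' ⧸ (colLat ϖ r a).addSubgroupOf (colLat ϖ r a'),
        cpair ψ c ((q.out : colLat ϖ r a') : Fin n → F) := by
    rw [Finset.mul_sum]
    refine (Fintype.sum_equiv (Equiv.addRight
      (QuotientAddGroup.mk (⟨y, hy⟩ : colLat ϖ r a'))) _ _ fun q => ?_).symm
    rw [Equiv.coe_addRight]
    have hrep : (QuotientAddGroup.mk ((q.out : colLat ϖ r a') + ⟨y, hy⟩) :
        colLat ϖ r a' ⧸ (colLat ϖ r a).addSubgroupOf (colLat ϖ r a')) =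
        q + QuotientAddGroup.mk (⟨y, hy⟩ : colLat ϖ r a') := by
      rw [QuotientAddGroup.mk_add, QuotientAddGroup.out_eq']
    rw [cpair_out_eq ψ hψ hϖ.ne_zero hc _ _ hrep, AddSubgroup.coe_add, cpair_add_right, mul_comm]
  have h1 : (1 - cpair ψ c y) * ∑ q : colLat ϖ r a' ⧸ (colLat ϖ r a).addSubgroupOf (colLat ϖ r a'),
        cpair ψ c ((q.out : colLat ϖ r a') : Fin n → F) = 0 := by
    rw [sub_mul, one_mul, ← key, sub_self]
  rcases mul_eq_zero.1 h1 with h | h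
  · exact absurd (sub_eq_zero.1 h).symm hne
  · exact h

end Fourier

/-! ### Column elements, row shears and diagonal `ϖ`-powers: shapes and conjugation -/

section Matrices

open WhittakerSupercuspidal

variable {F : Type*} [Field F] {n : ℕ}

/-- `c_t(x) ∈ U_n`. [folklore] -/
theorem colElem_mem_upperUnitriangular (t : Fin n) (x : Fin n → F) :
    colElem t x ∈ upperUnitriangular (Fin n) F := by
  rw [mem_upperUnitriangular_iff]
  refine ⟨fun i j hij => ?_, fun i => ?_⟩
  · have hne : i ≠ j := fun e => by subst e; exact lt_irrefl _ hij
    rw [colElem_apply, if_neg hne, zero_add, if_neg]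
    rintro ⟨h1, rfl⟩
    exact lt_asymm h1 hij
  · rw [colElem_apply, if_pos rfl, if_neg, add_zero]
    rintro ⟨h1, h2⟩; rw [h2] at h1; exact lt_irrefl _ h1

/-- The generic character on a column element: `∑_i c_t(x)_{i,i+1} = x_{t-1}`. [folklore] -/
theorem superdiagSum_colElem (t tp : Fin n) (htp : (tp : ℕ) + 1 = t) (x : Fin n → F) :
    superdiagSum ⟨colElem t x, colElem_mem_upperUnitriangular t x⟩ = x tp := by
  rw [superdiagSum_def]
  dsimp only
  rw [Finset.sum_eq_single tp]
  · rw [Finset.sum_eq_single t]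
    · rw [if_pos htp, colElem_apply, if_neg, zero_add, if_pos ⟨Fin.lt_def.2 (by omega), rfl⟩]
      exact fun h => by rw [Fin.ext_iff] at h; omega
    · intro j _ hjt
      by_cases h : (tp : ℕ) + 1 = j
      · exfalso; apply hjt; exact Fin.ext (by omega)
      · rw [if_neg h]
    · simp
  · intro i _ hit
    refine Finset.sum_eq_zero fun j _ => ?_
    by_cases h : (i : ℕ) + 1 = j
    · rw [if_pos h, colElem_apply, if_neg, zero_add, if_neg]
      · rintro ⟨-, rfl⟩; apply hit; exact Fin.ext (by omega)
      · exact fun e => by rw [Fin.ext_iff] at e; omega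
    · rw [if_neg h]
  · simp

/-- `ψ_U(c_t(x)) = ψ(x_{t-1})`. [folklore] -/
theorem whittakerCharFun_colElem (ψ : AddChar F Circle) (t tp : Fin n) (htp : (tp : ℕ) + 1 = t)
    (x : Fin n → F) :
    whittakerCharFun ψ ⟨colElem t x, colElem_mem_upperUnitriangular t x⟩ = ψ (x tp) := by
  rw [whittakerCharFun_apply, superdiagSum_colElem t tp htp]

/-- `ψ(x_{t-1}) = ψ_{e_{t-1}}(x)`. [folklore] -/
theorem cpair_single_one (ψ : AddChar F Circle) (tp : Fin n) (x : Fin n → F) :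
    cpair ψ (Pi.single tp 1) x = ψ (x tp) := by
  rw [cpair, single_one_dotProduct]

/-- The inverse of a top-left matrix is top-left. [folklore] -/
theorem IsTopLeft.inv {t : Fin n} {g : GL (Fin n) F} (hg : IsTopLeft t (g : Matrix (Fin n) (Fin n) F)) :
    IsTopLeft t ((g⁻¹ : GL (Fin n) F) : Matrix (Fin n) (Fin n) F) := by
  set h : Matrix (Fin n) (Fin n) F := ((g⁻¹ : GL (Fin n) F) : Matrix (Fin n) (Fin n) F) with hh
  have hgh : (g : Matrix (Fin n) (Fin n) F) * h = 1 := by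
    rw [hh, ← Units.val_mul, mul_inv_cancel, Units.val_one]
  have hhg : h * (g : Matrix (Fin n) (Fin n) F) = 1 := by
    rw [hh, ← Units.val_mul, inv_mul_cancel, Units.val_one]
  intro r c hrc
  rcases hrc with hr | hc
  · -- row `r ≥ t` of `g` is `e_r`, so row `r` of `g h = 1` is row `r` of `h`
    have := mul_apply_of_row_eq (g : Matrix (Fin n) (Fin n) F) h (fun l => hg r l (Or.inl hr)) c
    rw [hgh, Matrix.one_apply] at this
    exact this.symm
  · -- column `c ≥ t` of `g` is `e_c`, so column `c` of `h g = 1` is column `c` of `h`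
    have := mul_apply_of_col_eq h (g : Matrix (Fin n) (Fin n) F) (fun l => hg l c (Or.inr hc)) r
    rw [hhg, Matrix.one_apply] at this
    exact this.symm

/-- **Conjugation of the column group by `diag(g₀, 1)`**: `g c_t(x) g⁻¹ = c_t(g x̃)` for top-left `g`.
[folklore] -/
theorem topLeft_mul_colElem_mul_inv {t : Fin n} {g : GL (Fin n) F}
    (hg : IsTopLeft t (g : Matrix (Fin n) (Fin n) F)) (x : Fin n → F) :
    g * colElem t x * g⁻¹ = colElem t ((g : Matrix (Fin n) (Fin n) F) *ᵥ trunc t x) := by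
  have := topLeft_conj_colElem (IsTopLeft.inv hg) (by rw [inv_inv]; exact hg) x
  rwa [inv_inv] at this

/-- A diagonal `ϖ`-power with exponents supported in the rows `< t` is top-left of size `t`.
[folklore] -/
theorem isTopLeft_zpowDiagGL {ϖ : F} (hϖ : ϖ ≠ 0) {t : Fin n} {c : Fin n → ℤ}
    (hc : ∀ i, t ≤ i → c i = 0) : IsTopLeft t ((zpowDiagGL hϖ c : GL (Fin n) F) : Matrix (Fin n) (Fin n) F) := by
  intro r c' h
  rw [coe_zpowDiagGL, Matrix.diagonal_apply]
  by_cases hrc : r = c'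
  · subst hrc
    rw [if_pos rfl, if_pos rfl]
    rcases h with h | h <;> rw [hc r h, zpow_zero]
  · rw [if_neg hrc, if_neg hrc]

/-- **Conjugation of the column group by the torus**: `ϖ^c c_t(x) ϖ^{-c} = c_t((ϖ^{c_i - c_t} x_i)_i)`.
[folklore] -/
theorem zpowDiagGL_mul_colElem_mul_inv {ϖ : F} (hϖ : ϖ ≠ 0) (c : Fin n → ℤ) (t : Fin n)
    (x : Fin n → F) :
    zpowDiagGL hϖ c * colElem t x * (zpowDiagGL hϖ c)⁻¹ = colElem t fun i => ϖ ^ (c i - c t) * x i := by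
  apply Units.ext
  ext i j
  rw [coe_zpowDiagGL_mul_mul_inv_apply, colElem_apply, colElem_apply]
  by_cases hij : i = j
  · subst hij
    have h : ¬ (i < t ∧ i = t) := fun h => absurd h.1 (h.2 ▸ lt_irrefl _)
    simp [h]
  · simp only [if_neg hij, zero_add]
    by_cases h : i < t ∧ j = t
    · obtain ⟨h1, rfl⟩ := h
      simp [h1]
    · rw [if_neg h, if_neg h, mul_zero]

/-- A row shear of the row `tp < t` by a vector supported in `< t` is top-left of size `t`.
[folklore] -/
theorem isTopLeft_rowShear' {t tp : Fin n} (htp : tp < t) {q : Fin n → F}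
    (hq : ∀ i, t ≤ i → q i = 0) (h : 1 + q tp ≠ 0) :
    IsTopLeft t ((rowShear tp q h : GL (Fin n) F) : Matrix (Fin n) (Fin n) F) :=
  (isTopLeft_rowShear htp hq h).1

/-- `e_{tp} (1 + e_{tp} ⊗ q) = e_{tp} + q`: the row shear replaces the row `tp` of the identity by
`e_{tp} + q`. [folklore] -/
theorem single_vecMul_rowShear (tp : Fin n) (q : Fin n → F) (h : 1 + q tp ≠ 0) :
    (Pi.single tp (1 : F)) ᵥ* ((rowShear tp q h : GL (Fin n) F) : Matrix (Fin n) (Fin n) F) =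
      Pi.single tp 1 + q := by
  rw [vecMul_rowShear, Pi.single_eq_same, one_smul]

/-- A row shear fixes the other basis rows: `e_i (1 + e_{tp} ⊗ q) = e_i` for `i ≠ tp`. [folklore] -/
theorem single_vecMul_rowShear_of_ne {tp i : Fin n} (hi : i ≠ tp) (q : Fin n → F) (h : 1 + q tp ≠ 0) :
    (Pi.single i (1 : F)) ᵥ* ((rowShear tp q h : GL (Fin n) F) : Matrix (Fin n) (Fin n) F) =
      Pi.single i 1 := by
  rw [vecMul_rowShear, Pi.single_eq_of_ne hi.symm, zero_smul, add_zero]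

/-- A top-left matrix of size `t` fixes the basis rows of index `≥ t`: `e_i g = e_i` for `t ≤ i`.
[folklore] -/
theorem single_vecMul_of_isTopLeft {t i : Fin n} {g : GL (Fin n) F}
    (hg : IsTopLeft t (g : Matrix (Fin n) (Fin n) F)) (hi : t ≤ i) :
    (Pi.single i (1 : F)) ᵥ* (g : Matrix (Fin n) (Fin n) F) = Pi.single i 1 := by
  ext j
  rw [show ((Pi.single i (1 : F)) ᵥ* (g : Matrix (Fin n) (Fin n) F)) j =
      Pi.single i (1 : F) ⬝ᵥ fun l => (g : Matrix (Fin n) (Fin n) F) l j from rfl,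
    single_dotProduct, one_mul, hg i j (Or.inl hi), Pi.single_apply, eq_comm]
  split_ifs with h1 h2 h2
  · rfl
  · exact absurd h1.symm h2
  · exact absurd h2.symm h1
  · rfl

/-- Top-left shapes grow with the size. [folklore] -/
theorem IsTopLeft.of_le {t t' : Fin n} {M : Matrix (Fin n) (Fin n) F} (h : IsTopLeft t M) (ht : t ≤ t') :
    IsTopLeft t' M := fun r c hrc => h r c (hrc.imp (fun h' => ht.trans h') fun h' => ht.trans h')

/-- The row `t` of `c_t(y)` is `e_t`: `e_t c_t(y) = e_t`. [folklore] -/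
theorem single_vecMul_colElem (t : Fin n) (y : Fin n → F) :
    (Pi.single t (1 : F)) ᵥ* ((colElem t y : GL (Fin n) F) : Matrix (Fin n) (Fin n) F) = Pi.single t 1 := by
  ext j
  rw [show ((Pi.single t (1 : F)) ᵥ* ((colElem t y : GL (Fin n) F) : Matrix (Fin n) (Fin n) F)) j =
      Pi.single t (1 : F) ⬝ᵥ fun l => ((colElem t y : GL (Fin n) F) : Matrix (Fin n) (Fin n) F) l j from rfl,
    single_dotProduct, one_mul, colElem_row_eq t y le_rfl, Pi.single_apply, eq_comm]
  split_ifs with h1 h2 h2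
  · rfl
  · exact absurd h1.symm h2
  · exact absurd h2.symm h1
  · rfl

/-- A column element `c_{t'}(y)` is top-left of size `t` when `t' < t`. [folklore] -/
theorem isTopLeft_colElem {t t' : Fin n} (ht : t' < t) (y : Fin n → F) :
    IsTopLeft t ((colElem t' y : GL (Fin n) F) : Matrix (Fin n) (Fin n) F) := by
  intro r c h
  rw [colElem_apply]
  have : ¬ (r < t' ∧ c = t') := by
    rintro ⟨h1, rfl⟩
    rcases h with h | h
    · exact absurd (h1.trans ht) (not_lt.2 h)
    · exact absurd ht (not_lt.2 h)
  rw [if_neg this, add_zero]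

/-- The mulVec of a column element: `(c_{t'}(y) x)_i = x_i + [i < t'] y_i x_{t'}`. [folklore] -/
theorem colElem_mulVec_apply (t' : Fin n) (y x : Fin n → F) (i : Fin n) :
    (((colElem t' y : GL (Fin n) F) : Matrix (Fin n) (Fin n) F) *ᵥ x) i =
      x i + if i < t' then y i * x t' else 0 := by
  rw [coe_colElem, Matrix.add_mulVec, Matrix.one_mulVec, Pi.add_apply]
  congr 1
  rw [Matrix.mulVec, dotProduct]
  simp only [colMat_apply, ite_mul, zero_mul]
  by_cases hi : i < t'
  · rw [if_pos hi, Finset.sum_eq_single t']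
    · simp [hi]
    · intro j _ hj; simp [hj]
    · simp
  · rw [if_neg hi]
    exact Finset.sum_eq_zero fun j _ => by simp [hi]

/-- **Moving a column element past a later column**: for `t < t'`,
`c_t(y) c_{t'}(x) = c_{t'}(c_t(y) x̃) c_t(y)` (`C_t` normalises `C_{t'}` inside `U_n`). [folklore] -/
theorem colElem_mul_colElem_of_lt {t t' : Fin n} (ht : t < t') (y x : Fin n → F) :
    colElem t y * colElem t' x =
      colElem t' (((colElem t y : GL (Fin n) F) : Matrix (Fin n) (Fin n) F) *ᵥ trunc t' x) * colElem t y := by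
  rw [← topLeft_mul_colElem_mul_inv (isTopLeft_colElem ht y) x, inv_mul_cancel_right]

/-- The relevant coordinate is unchanged: `(c_t(y) x̃)_{i} = x_i` for `t ≤ i < t'`. [folklore] -/
theorem colElem_mulVec_trunc_apply_of_le {t t' i : Fin n} (hti : t ≤ i) (hit : i < t') (y x : Fin n → F) :
    (((colElem t y : GL (Fin n) F) : Matrix (Fin n) (Fin n) F) *ᵥ trunc t' x) i = x i := by
  rw [colElem_mulVec_apply, if_neg (not_lt.2 hti), add_zero, trunc_apply, if_pos hit]

end Matrices

/-! ### Integrality: column elements and row shears in `GL_n(𝒪)` and in congruence subgroups -/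

section Integral

open WhittakerSupercuspidal

variable {F : Type*} [Field F] [ValuativeRel F] {n : ℕ}

/-- An integral column element lies in `GL_n(𝒪)`. [folklore] -/
theorem colElem_mem_glInt {t : Fin n} {x : Fin n → F} (hx : ∀ i, i < t → x i ∈ 𝒪[F]) :
    colElem t x ∈ glInt n F := by
  rw [mem_glInt_iff]
  refine ⟨fun i j => ?_, fun i j => ?_⟩
  · rw [colElem_apply]
    refine Subring.add_mem _ ?_ ?_
    · split_ifs <;> simp
    · split_ifs with h
      · exact hx i h.1
      · exact Subring.zero_mem _
  · rw [colElem_inv, colElem_apply]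
    refine Subring.add_mem _ ?_ ?_
    · split_ifs <;> simp
    · split_ifs with h
      · exact Subring.neg_mem _ (hx i h.1)
      · exact Subring.zero_mem _

/-- A column element with small entries lies in the congruence subgroup of that level. [folklore] -/
theorem colElem_mem_congruenceGL {t : Fin n} {x : Fin n → F} {γ : ValueGroupWithZero F} (hγ : γ ≤ 1)
    (hx : ∀ i, i < t → valuation F (x i) ≤ γ) : colElem t x ∈ congruenceGL n γ := by
  have hX : ∀ y : Fin n → F, (∀ i, i < t → valuation F (y i) ≤ γ) → ValBound γ (colMat t y) := by
    intro y hy i j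
    rw [colMat_apply]
    split_ifs with h
    · exact hy i h.1
    · rw [map_zero]; exact zero_le
  have hneg : ∀ i, i < t → valuation F ((-x) i) ≤ γ := fun i hi => by
    rw [Pi.neg_apply, Valuation.map_neg]; exact hx i hi
  rw [mem_congruenceGL_iff]
  refine ⟨⟨?_, ?_⟩, ?_, ?_⟩
  · rw [coe_colElem]
    exact (ValBound.of_sub_one (by rw [add_sub_cancel_left]; exact (hX x hx).mono hγ) le_rfl)
  · rw [colElem_inv, coe_colElem]
    exact (ValBound.of_sub_one (by rw [add_sub_cancel_left]; exact (hX _ hneg).mono hγ) le_rfl)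
  · rw [coe_colElem, add_sub_cancel_left]; exact hX x hx
  · rw [colElem_inv, coe_colElem, add_sub_cancel_left]; exact hX _ hneg

/-- A row shear `1 + e_{tp} ⊗ q` with `q` integral and `1 + q_{tp}` a unit lies in `GL_n(𝒪)`.
[folklore] -/
theorem rowShear_mem_glInt {tp : Fin n} {q : Fin n → F} (hq : ∀ i, q i ∈ 𝒪[F])
    (hu : valuation F (1 + q tp) = 1) :
    rowShear tp q (fun h => by rw [h, map_zero] at hu; exact zero_ne_one hu) ∈ glInt n F := by
  rw [mem_glInt_iff]
  refine ⟨fun i j => ?_, fun i j => ?_⟩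
  · rw [coe_rowShear, Matrix.add_apply, rowMat_apply]
    refine Subring.add_mem _ ?_ ?_
    · rw [Matrix.one_apply]; split_ifs <;> simp
    · split_ifs
      · exact hq j
      · exact Subring.zero_mem _
  · rw [coe_rowShear_inv, Matrix.sub_apply, Matrix.smul_apply, rowMat_apply]
    refine Subring.sub_mem _ ?_ ?_
    · rw [Matrix.one_apply]; split_ifs <;> simp
    · split_ifs
      · rw [smul_eq_mul, Valuation.mem_integer_iff, map_mul, map_inv₀, hu, inv_one, one_mul]
        exact (Valuation.mem_integer_iff _ _).1 (hq j)
      · rw [smul_zero]; exact Subring.zero_mem _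

/-- `|1 + y| = 1` for `|y| < 1`. [folklore] -/
theorem valuation_one_add_eq_one {y : F} (hy : valuation F y < 1) : valuation F (1 + y) = 1 := by
  rw [← (valuation F).map_one]
  exact Valuation.map_add_eq_of_lt_left _ (by rwa [Valuation.map_one])

/-- A row shear with small `q` lies in the congruence subgroup of that level. [folklore] -/
theorem rowShear_mem_congruenceGL {tp : Fin n} {q : Fin n → F} {γ : ValueGroupWithZero F} (hγ : γ < 1)
    (hq : ∀ i, valuation F (q i) ≤ γ) :
    rowShear tp q (fun h => by
      have := valuation_one_add_eq_one ((hq tp).trans_lt hγ); rw [h, map_zero] at this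
      exact zero_ne_one this) ∈ congruenceGL n γ := by
  have hu : valuation F (1 + q tp) = 1 := valuation_one_add_eq_one ((hq tp).trans_lt hγ)
  have hR : ValBound γ (rowMat tp q) := fun i j => by
    rw [rowMat_apply]; split_ifs
    · exact hq j
    · rw [map_zero]; exact zero_le
  have hR' : ValBound γ ((1 + q tp)⁻¹ • rowMat tp q) := fun i j => by
    rw [Matrix.smul_apply, smul_eq_mul, map_mul, map_inv₀, hu, inv_one, one_mul]; exact hR i j
  rw [mem_congruenceGL_iff]
  refine ⟨⟨?_, ?_⟩, ?_, ?_⟩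
  · rw [coe_rowShear]
    exact ValBound.of_sub_one (by rw [add_sub_cancel_left]; exact hR) hγ.le
  · rw [coe_rowShear_inv]
    refine ValBound.of_sub_one ?_ hγ.le
    rw [sub_sub_cancel_left]; exact hR'.neg
  · rw [coe_rowShear, add_sub_cancel_left]; exact hR
  · rw [coe_rowShear_inv, sub_sub_cancel_left]; exact hR'.neg

/-- `GL_n(𝒪)` preserves the square column lattices: `g L_{N} = L_N` entrywise, i.e. `g x̃ ∈ L_N` for
`x ∈ L_N` (constant exponent `N` on the rows `< t`) and `g` top-left integral. [folklore] -/
theorem mulVec_mem_colLat_of_mem_glInt {ϖ : F} {t : Fin n} {g : GL (Fin n) F} (hg : g ∈ glInt n F)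
    (ht : IsTopLeft t (g : Matrix (Fin n) (Fin n) F)) {N : ℤ} {x : Fin n → F}
    (hx : x ∈ colLat ϖ t (fun _ => N)) :
    (g : Matrix (Fin n) (Fin n) F) *ᵥ x ∈ colLat ϖ t (fun _ => N) := by
  rw [mem_glInt_iff] at hg
  refine ⟨fun i hi => ?_, fun i hi => ?_⟩
  · rw [mem_zBall_iff, Matrix.mulVec, dotProduct]
    refine Valuation.map_sum_le _ fun j _ => ?_
    rw [map_mul]
    by_cases hj : j < t
    · calc valuation F ((g : Matrix (Fin n) (Fin n) F) i j) * valuation F (x j)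
          ≤ 1 * valuation F (ϖ ^ N) :=
            mul_le_mul' ((Valuation.mem_integer_iff _ _).1 (hg.1 i j)) (mem_zBall_iff.1 (hx.1 j hj))
        _ = valuation F (ϖ ^ N) := one_mul _
    · rw [hx.2 j hj, map_zero, mul_zero]; exact zero_le
  · rw [Matrix.mulVec, dotProduct]
    refine Finset.sum_eq_zero fun j _ => ?_
    by_cases hj : j < t
    · have hij : i ≠ j := fun e => hi (e ▸ hj)
      rw [ht i j (Or.inl (not_lt.1 hi)), if_neg hij, zero_mul]
    · rw [hx.2 j hj, mul_zero]

end Integral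

/-! ### Smallness: small balls below any level, open subgroups contain small column lattices and
nearby row shears -/

section Small

open WhittakerSupercuspidal
open scoped Topology

variable {F : Type*} [Field F] [ValuativeRel F] {n : ℕ} {ϖ : F}

/-- **Every level is undercut by a power of `ϖ`** (`𝒪` is a discrete valuation ring): for a unit
`γ` of the value group there is `k ∈ ℤ` with `|ϖ^k| ≤ γ`. [folklore] -/
theorem exists_valuation_zpow_le [IsDiscreteValuationRing 𝒪[F]] (hϖ : IsUniformizingElement ϖ)
    (γ : (ValueGroupWithZero F)ˣ) : ∃ k : ℤ, valuation F (ϖ ^ k) ≤ γ := by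
  by_cases h1 : (1 : ValueGroupWithZero F) ≤ γ
  · exact ⟨0, by rwa [zpow_zero, map_one]⟩
  rw [not_le] at h1
  obtain ⟨s, hs⟩ := ValuativeRel.valuation_surjective (γ : ValueGroupWithZero F)
  have hs0 : s ≠ 0 := by
    rintro rfl
    rw [map_zero] at hs
    exact γ.ne_zero hs.symm
  have hsO : s ∈ 𝒪[F] := (Valuation.mem_integer_iff _ _).2 (by rw [hs]; exact h1.le)
  have hs'0 : (⟨s, hsO⟩ : 𝒪[F]) ≠ 0 := fun h => hs0 (congrArg Subtype.val h)
  obtain ⟨m, u, hsu⟩ := IsDiscreteValuationRing.eq_unit_mul_pow_irreducible hs'0 hϖ.irreducible_coe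
  refine ⟨m, ?_⟩
  have hu : valuation F ((u : 𝒪[F]) : F) = 1 :=
    (Valuation.integer.integers (valuation F)).isUnit_iff_valuation_eq_one.1 u.isUnit
  have : s = ((u : 𝒪[F]) : F) * ϖ ^ (m : ℤ) := by
    have := congrArg Subtype.val hsu
    simpa [zpow_natCast] using this
  rw [← hs, this, map_mul, hu, one_mul]

/-- Every element lies in the balls `ϖ^k 𝒪` for all small enough `k`. [folklore] -/
theorem exists_forall_mem_zBall [IsDiscreteValuationRing 𝒪[F]] (hϖ : IsUniformizingElement ϖ) (x : F) :
    ∃ k : ℤ, ∀ k', k' ≤ k → x ∈ zBall ϖ k' := by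
  by_cases hx : x = 0
  · exact ⟨0, fun k' _ => by rw [hx]; exact AddSubgroup.zero_mem _⟩
  have hvx : valuation F x ≠ 0 := by rwa [ne_eq, map_eq_zero]
  obtain ⟨k, hk⟩ := exists_valuation_zpow_le hϖ (Units.mk0 (valuation F x) hvx)⁻¹
  refine ⟨-k, fun k' hk' => zBall_anti hϖ.ne_zero hϖ.valuation_le_one hk' ?_⟩
  rw [mem_zBall_iff, _root_.zpow_neg, map_inv₀]
  rw [Units.val_inv_eq_inv_val, Units.val_mk0] at hk
  have h0 : valuation F (ϖ ^ k) ≠ 0 := by rw [ne_eq, map_eq_zero]; exact zpow_ne_zero k hϖ.ne_zero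
  rw [le_inv_comm₀ (zero_lt_iff.2 hvx) (zero_lt_iff.2 h0)]
  exact hk

/-- Uniform version on the rows `< r`: a small *square* column lattice sits inside the box of
level `γ`. [folklore] -/
theorem exists_colLat_valuation_le [IsDiscreteValuationRing 𝒪[F]] (hϖ : IsUniformizingElement ϖ)
    (γ : (ValueGroupWithZero F)ˣ) (r : Fin n) :
    ∃ k : ℤ, ∀ x ∈ colLat ϖ r (fun _ => k), ∀ i, valuation F (x i) ≤ γ := by
  obtain ⟨k, hk⟩ := exists_valuation_zpow_le hϖ γ
  refine ⟨k, fun x hx i => ?_⟩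
  by_cases hi : i < r
  · exact (mem_zBall_iff.1 (hx.1 i hi)).trans hk
  · rw [hx.2 i hi, map_zero]; exact zero_le

variable [TopologicalSpace F] [IsNonarchimedeanLocalField F]

/-- **Open subgroups contain small column lattices**: for an open subgroup `K` of `GL_n(F)` there is
`k` with `c_t(x) ∈ K` for all `x` in the square column lattice `ϖ^k 𝒪^t`. [folklore] -/
theorem exists_colLat_colElem_mem (hϖ : IsUniformizingElement ϖ) {K : Subgroup (GL (Fin n) F)}
    (hK : IsOpen (K : Set (GL (Fin n) F))) (t : Fin n) :
    ∃ k : ℤ, ∀ x ∈ colLat ϖ t (fun _ => k), colElem t x ∈ K := by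
  obtain ⟨γ, hγ⟩ := exists_congruenceGL_subset (hK.mem_nhds K.one_mem)
  -- shrink `γ` below `1`
  set δ : (ValueGroupWithZero F)ˣ := min γ (Units.mk0 (valuation F ϖ)
    (by rw [ne_eq, map_eq_zero]; exact hϖ.ne_zero)) with hδ
  have hδγ : (δ : ValueGroupWithZero F) ≤ γ := by
    rw [hδ]; exact_mod_cast min_le_left _ _
  have hδ1 : (δ : ValueGroupWithZero F) ≤ 1 := by
    rw [hδ]
    refine le_trans ?_ hϖ.valuation_le_one
    exact_mod_cast min_le_right γ _
  obtain ⟨k, hk⟩ := exists_colLat_valuation_le hϖ δ t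
  refine ⟨k, fun x hx => hγ ?_⟩
  exact congruenceGL_mono hδγ (colElem_mem_congruenceGL hδ1 fun i _ => hk x hx i)

/-- **Open subgroups contain the nearby row shears**: for an open subgroup `K` of `GL_n(F)` there is
`k` such that every row shear `1 + e_{tp} ⊗ q` with `q` in the box `ϖ^k 𝒪ⁿ` is defined and lies in
`K`. [folklore] -/
theorem exists_rowShear_mem (hϖ : IsUniformizingElement ϖ) {K : Subgroup (GL (Fin n) F)}
    (hK : IsOpen (K : Set (GL (Fin n) F))) (tp : Fin n) :
    ∃ k : ℤ, ∀ q : Fin n → F, (∀ i, q i ∈ zBall ϖ k) →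
      ∃ h : 1 + q tp ≠ 0, rowShear tp q h ∈ K := by
  obtain ⟨γ, hγ⟩ := exists_congruenceGL_subset (hK.mem_nhds K.one_mem)
  -- shrink `γ` strictly below `1`
  set δ : (ValueGroupWithZero F)ˣ := min γ (Units.mk0 (valuation F ϖ)
    (by rw [ne_eq, map_eq_zero]; exact hϖ.ne_zero)) with hδ
  have hδγ : (δ : ValueGroupWithZero F) ≤ γ := by
    rw [hδ]; exact_mod_cast min_le_left _ _
  have hδ1 : (δ : ValueGroupWithZero F) < 1 := by
    rw [hδ]
    refine lt_of_le_of_lt ?_ hϖ.valuation_lt_one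
    exact_mod_cast min_le_right γ _
  obtain ⟨k, hk⟩ := exists_valuation_zpow_le hϖ δ
  refine ⟨k, fun q hq => ?_⟩
  have hq' : ∀ i, valuation F (q i) ≤ δ := fun i => (mem_zBall_iff.1 (hq i)).trans hk
  exact ⟨_, hγ (congruenceGL_mono hδγ (rowShear_mem_congruenceGL hδ1 hq'))⟩

end Small

/-! ## Twisted averages over column lattices on a representation -/

section TwSum

open WhittakerSupercuspidal

variable {F : Type*} [Field F] [ValuativeRel F] {n : ℕ}
  {V : Type*} [AddCommGroup V] [Module ℂ V]
  (ρ : Representation ℂ (GL (Fin n) F) V) (ψ : AddChar F Circle) (ϖ : F)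

/-- The finite quotient `L_{a'} / L_a` of two column lattices of the column `t`. [folklore] -/
abbrev LQ (t : Fin n) (a' a : Fin n → ℤ) : Type _ :=
  ↥(colLat ϖ t a') ⧸ (colLat ϖ t a).addSubgroupOf (colLat ϖ t a')

/-- The **twisted sum** `∑_{q ∈ L_{a'}/L_a} ψ_b(q̃)⁻¹ ρ(c_t(q̃)) v` over coset representatives
(Haar-measure-free form of `[L_{a'} : L_a] ∫_{L_{a'}} ψ_b(x)⁻¹ ρ(c_t(x)) v dx / vol(L_a)`; junk value `0`
if the quotient is infinite). [folklore] -/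
def twSum (t : Fin n) (a' a : Fin n → ℤ) (b : Fin n → F) (v : V) : V :=
  ∑ᶠ q : LQ ϖ t a' a,
    cpair ψ b (-((q.out : colLat ϖ t a') : Fin n → F)) • ρ (colElem t ((q.out : colLat ϖ t a') : Fin n → F)) v

variable {ρ ψ ϖ}

/-- The twisted sum as a finite sum. [folklore] -/
theorem twSum_eq_sum (t : Fin n) (a' a : Fin n → ℤ) (b : Fin n → F) (v : V) [Fintype (LQ ϖ t a' a)] :
    twSum ρ ψ ϖ t a' a b v = ∑ q : LQ ϖ t a' a,
      cpair ψ b (-((q.out : colLat ϖ t a') : Fin n → F)) •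
        ρ (colElem t ((q.out : colLat ϖ t a') : Fin n → F)) v := by
  rw [twSum, finsum_eq_sum_of_fintype]

omit [ValuativeRel F] in
/-- The action of the column group is additive: `ρ(c_t(x + y)) = ρ(c_t(x)) ρ(c_t(y))`. [folklore] -/
theorem apply_colElem_add (t : Fin n) (x y : Fin n → F) (v : V) :
    ρ (colElem t (x + y)) v = ρ (colElem t x) (ρ (colElem t y) v) := by
  rw [colElem_add, map_mul, Module.End.mul_apply]

omit [ValuativeRel F] in
/-- The column group is commutative. [folklore] -/
theorem apply_colElem_comm (t : Fin n) (x y : Fin n → F) (v : V) :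
    ρ (colElem t x) (ρ (colElem t y) v) = ρ (colElem t y) (ρ (colElem t x) v) := by
  rw [← apply_colElem_add, add_comm, apply_colElem_add]

/-- **The summand only depends on the coset**: for `z ∈ L_{a'}` in the class `q`, with `v` fixed by
`L_a` and `ψ_b` trivial on `L_a`, `ψ_b(q̃)⁻¹ ρ(c_t(q̃)) v = ψ_b(z)⁻¹ ρ(c_t(z)) v`. [folklore] -/
theorem summand_eq_of_mk_eq (hψ : ∀ c ∈ 𝒪[F], ψ c = 1) (hϖ0 : ϖ ≠ 0) {t : Fin n} {a' a : Fin n → ℤ}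
    {b : Fin n → F} {v : V} (hfix : ∀ x ∈ colLat ϖ t a, ρ (colElem t x) v = v)
    (hb : ∀ i, i < t → b i ∈ zBall ϖ (-a i)) (z : colLat ϖ t a') (q : LQ ϖ t a' a)
    (hq : (QuotientAddGroup.mk z : LQ ϖ t a' a) = q) :
    cpair ψ b (-((q.out : colLat ϖ t a') : Fin n → F)) • ρ (colElem t ((q.out : colLat ϖ t a') : Fin n → F)) v =
      cpair ψ b (-(z : Fin n → F)) • ρ (colElem t (z : Fin n → F)) v := by
  have hmem : -(z : Fin n → F) + ((q.out : colLat ϖ t a') : Fin n → F) ∈ colLat ϖ t a := by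
    have : (QuotientAddGroup.mk z : LQ ϖ t a' a) = QuotientAddGroup.mk q.out := by
      rw [QuotientAddGroup.out_eq']; exact hq
    have := QuotientAddGroup.eq.1 this
    rw [AddSubgroup.mem_addSubgroupOf] at this
    simpa using this
  set d : Fin n → F := -(z : Fin n → F) + ((q.out : colLat ϖ t a') : Fin n → F) with hd
  have hq' : ((q.out : colLat ϖ t a') : Fin n → F) = (z : Fin n → F) + d := by rw [hd]; abel
  rw [hq', apply_colElem_add, hfix _ hmem, neg_add, cpair_add_right,
    cpair_eq_one_of_mem ψ hψ hϖ0 hb ((colLat ϖ t a).neg_mem hmem), mul_one]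

/-- **Summation over any family of representatives**: if `j ↦ [z_j]` is a bijection onto
`L_{a'}/L_a`, the twisted sum may be computed on the `z_j`. [folklore] -/
theorem twSum_eq_sum_of_bijective (hψ : ∀ c ∈ 𝒪[F], ψ c = 1) (hϖ0 : ϖ ≠ 0) {t : Fin n}
    {a' a : Fin n → ℤ} {b : Fin n → F} {v : V} (hfix : ∀ x ∈ colLat ϖ t a, ρ (colElem t x) v = v)
    (hb : ∀ i, i < t → b i ∈ zBall ϖ (-a i)) [Fintype (LQ ϖ t a' a)] {J : Type*} [Fintype J]
    (z : J → colLat ϖ t a') (hz : Function.Bijective fun j => (QuotientAddGroup.mk (z j) : LQ ϖ t a' a)) :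
    twSum ρ ψ ϖ t a' a b v = ∑ j, cpair ψ b (-(z j : Fin n → F)) • ρ (colElem t (z j : Fin n → F)) v := by
  rw [twSum_eq_sum]
  symm
  refine Fintype.sum_bijective _ hz _ _ fun j => ?_
  exact (summand_eq_of_mk_eq hψ hϖ0 hfix hb (z j) _ rfl).symm

/-- **Equivariance in the vector**: `S(ρ(c_t(y)) v) = ψ_b(y) S(v)` for `y ∈ L_{a'}` (translation by `y`
permutes `L_{a'}/L_a`; the computation behind the Jacquet–Langlands lemma, Bump 1997, Prop. 4.4.1).
[folklore] -/
theorem twSum_apply_colElem (hψ : ∀ c ∈ 𝒪[F], ψ c = 1) (hϖ0 : ϖ ≠ 0) {t : Fin n} {a' a : Fin n → ℤ}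
    {b : Fin n → F} {v : V} (hfix : ∀ x ∈ colLat ϖ t a, ρ (colElem t x) v = v)
    (hb : ∀ i, i < t → b i ∈ zBall ϖ (-a i)) [Fintype (LQ ϖ t a' a)] {y : Fin n → F}
    (hy : y ∈ colLat ϖ t a') :
    twSum ρ ψ ϖ t a' a b (ρ (colElem t y) v) = cpair ψ b y • twSum ρ ψ ϖ t a' a b v := by
  -- compute the right-hand sum on the representatives `q̃ + y`
  have hbij : Function.Bijective fun q : LQ ϖ t a' a =>
      (QuotientAddGroup.mk ((q.out : colLat ϖ t a') + ⟨y, hy⟩) : LQ ϖ t a' a) := by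
    have : (fun q : LQ ϖ t a' a => (QuotientAddGroup.mk ((q.out : colLat ϖ t a') + ⟨y, hy⟩) : LQ ϖ t a' a)) =
        Equiv.addRight (QuotientAddGroup.mk (⟨y, hy⟩ : colLat ϖ t a')) := by
      funext q
      rw [Equiv.coe_addRight, QuotientAddGroup.mk_add, QuotientAddGroup.out_eq']
    rw [this]; exact Equiv.bijective _
  rw [twSum_eq_sum_of_bijective hψ hϖ0 hfix hb _ hbij, twSum_eq_sum, Finset.smul_sum]
  refine Finset.sum_congr rfl fun q _ => ?_
  rw [← apply_colElem_add, smul_smul, AddSubgroup.coe_add]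
  congr 1
  rw [neg_add, cpair_add_right, mul_left_comm, ← cpair_add_right, add_neg_cancel, cpair_zero_right,
    mul_one]

/-- **Equivariance of the twisted sum**: `ρ(c_t(y)) S(v) = ψ_b(y) S(v)` for `y ∈ L_{a'}`: the twisted
sum is `(L_{a'}, ψ_b)`-equivariant. [folklore] -/
theorem apply_colElem_twSum (hψ : ∀ c ∈ 𝒪[F], ψ c = 1) (hϖ0 : ϖ ≠ 0) {t : Fin n} {a' a : Fin n → ℤ}
    {b : Fin n → F} {v : V} (hfix : ∀ x ∈ colLat ϖ t a, ρ (colElem t x) v = v)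
    (hb : ∀ i, i < t → b i ∈ zBall ϖ (-a i)) [Fintype (LQ ϖ t a' a)] {y : Fin n → F}
    (hy : y ∈ colLat ϖ t a') :
    ρ (colElem t y) (twSum ρ ψ ϖ t a' a b v) = cpair ψ b y • twSum ρ ψ ϖ t a' a b v := by
  rw [← twSum_apply_colElem hψ hϖ0 hfix hb hy, twSum_eq_sum, twSum_eq_sum, map_sum]
  refine Finset.sum_congr rfl fun q _ => ?_
  rw [map_smul, apply_colElem_comm]

omit [ValuativeRel F] in
/-- `ψ_b(-x) ψ_{b'}(x) = ψ_{b'-b}(x)`. [folklore] -/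
theorem cpair_neg_mul_cpair (b b' x : Fin n → F) :
    cpair ψ b (-x) * cpair ψ b' x = cpair ψ (b' - b) x := by
  rw [cpair_neg_right, sub_eq_add_neg, cpair_add_left, cpair_neg_left, mul_comm]

/-- **Twisted sum of an equivariant vector**: if `ρ(c_t(y)) u = ψ_{b'}(y) u` on `L_{a'}`, then
`S_b(u) = (∑_{q} ψ_{b'-b}(q̃)) • u`. [folklore] -/
theorem twSum_of_equivariant {t : Fin n} {a' a : Fin n → ℤ} {b b' : Fin n → F} {u : V}
    (hu : ∀ y ∈ colLat ϖ t a', ρ (colElem t y) u = cpair ψ b' y • u) [Fintype (LQ ϖ t a' a)] :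
    twSum ρ ψ ϖ t a' a b u =
      (∑ q : LQ ϖ t a' a, cpair ψ (b' - b) ((q.out : colLat ϖ t a') : Fin n → F)) • u := by
  rw [twSum_eq_sum, Finset.sum_smul]
  refine Finset.sum_congr rfl fun q _ => ?_
  rw [hu _ (q.out).2, smul_smul, cpair_neg_mul_cpair]

/-- Twisted sum of a `(L_{a'}, ψ_b)`-equivariant vector for the same character: `[L_{a'} : L_a] • u`.
[folklore] -/
theorem twSum_of_equivariant_self {t : Fin n} {a' a : Fin n → ℤ} {b : Fin n → F} {u : V}
    (hu : ∀ y ∈ colLat ϖ t a', ρ (colElem t y) u = cpair ψ b y • u) [Fintype (LQ ϖ t a' a)] :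
    twSum ρ ψ ϖ t a' a b u = (Fintype.card (LQ ϖ t a' a) : ℂ) • u := by
  rw [twSum_of_equivariant hu]
  simp only [sub_self, cpair_zero_left, Finset.sum_const, Finset.card_univ, nsmul_eq_mul, mul_one]

/-- Two twisted sums (any big/small lattices, any characters) commute, the column group being
commutative. [folklore] -/
theorem twSum_twSum_comm {t : Fin n} {a₁' a₁ a₂' a₂ : Fin n → ℤ} {b₁ b₂ : Fin n → F} (v : V)
    [Fintype (LQ ϖ t a₁' a₁)] [Fintype (LQ ϖ t a₂' a₂)] :
    twSum ρ ψ ϖ t a₁' a₁ b₁ (twSum ρ ψ ϖ t a₂' a₂ b₂ v) =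
      twSum ρ ψ ϖ t a₂' a₂ b₂ (twSum ρ ψ ϖ t a₁' a₁ b₁ v) := by
  simp only [twSum_eq_sum, map_sum, map_smul, Finset.smul_sum]
  rw [Finset.sum_comm]
  refine Finset.sum_congr rfl fun q _ => Finset.sum_congr rfl fun p _ => ?_
  rw [smul_comm, apply_colElem_comm]

/-- **Independence of the small lattice** (unnormalised form): for `a' ≤ a ≤ a₂` on the rows `< t`,
with `v` fixed by `L_a` and `ψ_b` trivial on `L_a`,
`[L_{a'} : L_{a₂}] • S_{a}(v) = [L_{a'} : L_a] • S_{a₂}(v)`. [folklore] -/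
theorem card_smul_twSum_eq (hψ : ∀ c ∈ 𝒪[F], ψ c = 1) (hϖ0 : ϖ ≠ 0) (hϖ1 : valuation F ϖ ≤ 1)
    {t : Fin n} {a' a a₂ : Fin n → ℤ} {b : Fin n → F} {v : V} (h12 : ∀ i, i < t → a i ≤ a₂ i)
    (hfix : ∀ x ∈ colLat ϖ t a, ρ (colElem t x) v = v) (hb : ∀ i, i < t → b i ∈ zBall ϖ (-a i))
    [Fintype (LQ ϖ t a' a)] [Fintype (LQ ϖ t a' a₂)] :
    (Fintype.card (LQ ϖ t a' a₂) : ℂ) • twSum ρ ψ ϖ t a' a b v =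
      (Fintype.card (LQ ϖ t a' a) : ℂ) • twSum ρ ψ ϖ t a' a₂ b v := by
  have hfix₂ : ∀ x ∈ colLat ϖ t a₂, ρ (colElem t x) v = v := fun x hx =>
    hfix x (colLat_mono hϖ0 hϖ1 h12 hx)
  have hb₂ : ∀ i, i < t → b i ∈ zBall ϖ (-a₂ i) := fun i hi =>
    zBall_anti hϖ0 hϖ1 (neg_le_neg (h12 i hi)) (hb i hi)
  rw [← twSum_of_equivariant_self fun y hy => apply_colElem_twSum hψ hϖ0 hfix hb hy,
    twSum_twSum_comm, twSum_of_equivariant_self fun y hy => apply_colElem_twSum hψ hϖ0 hfix₂ hb₂ hy]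

/-- The **normalised twisted average** `e_{a',b} v = [L_{a'} : L_a]⁻¹ ∑_{L_{a'}/L_a} ψ_b(q̃)⁻¹ ρ(c_t(q̃)) v`
computed with the explicit small lattice `L_a` (the finite form of `vol(L_{a'})⁻¹ ∫_{L_{a'}} ψ_b⁻¹ ρ`).
[folklore] -/
def twAvg (ρ : Representation ℂ (GL (Fin n) F) V) (ψ : AddChar F Circle) (ϖ : F) (t : Fin n)
    (a' a : Fin n → ℤ) (b : Fin n → F) (v : V) : V :=
  ((Nat.card (LQ ϖ t a' a) : ℂ))⁻¹ • twSum ρ ψ ϖ t a' a b v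

/-- **Independence of the small lattice** for the normalised average (`a ≤ a₂` comparable case).
[folklore] -/
theorem twAvg_eq_twAvg_of_le (hψ : ∀ c ∈ 𝒪[F], ψ c = 1) (hϖ0 : ϖ ≠ 0) (hϖ1 : valuation F ϖ ≤ 1)
    {t : Fin n} {a' a a₂ : Fin n → ℤ} {b : Fin n → F} {v : V} (h12 : ∀ i, i < t → a i ≤ a₂ i)
    (hfix : ∀ x ∈ colLat ϖ t a, ρ (colElem t x) v = v) (hb : ∀ i, i < t → b i ∈ zBall ϖ (-a i))
    [Finite (LQ ϖ t a' a)] [Finite (LQ ϖ t a' a₂)] :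
    twAvg ρ ψ ϖ t a' a b v = twAvg ρ ψ ϖ t a' a₂ b v := by
  haveI : Fintype (LQ ϖ t a' a) := Fintype.ofFinite _
  haveI : Fintype (LQ ϖ t a' a₂) := Fintype.ofFinite _
  have h1 : (Fintype.card (LQ ϖ t a' a) : ℂ) ≠ 0 := by
    rw [Nat.cast_ne_zero]; exact Fintype.card_ne_zero
  have h2 : (Fintype.card (LQ ϖ t a' a₂) : ℂ) ≠ 0 := by
    rw [Nat.cast_ne_zero]; exact Fintype.card_ne_zero
  have key := card_smul_twSum_eq (a' := a') hψ hϖ0 hϖ1 h12 hfix hb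
  rw [twAvg, twAvg, Nat.card_eq_fintype_card, Nat.card_eq_fintype_card]
  calc ((Fintype.card (LQ ϖ t a' a) : ℂ))⁻¹ • twSum ρ ψ ϖ t a' a b v
      = (((Fintype.card (LQ ϖ t a' a) : ℂ))⁻¹ * ((Fintype.card (LQ ϖ t a' a₂) : ℂ))⁻¹) •
          ((Fintype.card (LQ ϖ t a' a₂) : ℂ) • twSum ρ ψ ϖ t a' a b v) := by
        rw [smul_smul, mul_assoc, inv_mul_cancel₀ h2, mul_one]
    _ = (((Fintype.card (LQ ϖ t a' a) : ℂ))⁻¹ * ((Fintype.card (LQ ϖ t a' a₂) : ℂ))⁻¹) •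
          ((Fintype.card (LQ ϖ t a' a) : ℂ) • twSum ρ ψ ϖ t a' a₂ b v) := by rw [key]
    _ = ((Fintype.card (LQ ϖ t a' a₂) : ℂ))⁻¹ • twSum ρ ψ ϖ t a' a₂ b v := by
        rw [smul_smul, mul_comm ((Fintype.card (LQ ϖ t a' a) : ℂ))⁻¹, mul_assoc, inv_mul_cancel₀ h1,
          mul_one]

/-- The twisted sum is additive in the vector. [folklore] -/
theorem twSum_add (t : Fin n) (a' a : Fin n → ℤ) (b : Fin n → F) (v w : V) [Fintype (LQ ϖ t a' a)] :
    twSum ρ ψ ϖ t a' a b (v + w) = twSum ρ ψ ϖ t a' a b v + twSum ρ ψ ϖ t a' a b w := by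
  simp only [twSum_eq_sum, map_add, smul_add, Finset.sum_add_distrib]

/-- The twisted sum is homogeneous in the vector. [folklore] -/
theorem twSum_smul (t : Fin n) (a' a : Fin n → ℤ) (b : Fin n → F) (c : ℂ) (v : V)
    [Fintype (LQ ϖ t a' a)] :
    twSum ρ ψ ϖ t a' a b (c • v) = c • twSum ρ ψ ϖ t a' a b v := by
  simp only [twSum_eq_sum, map_smul, Finset.smul_sum, smul_comm c]

/-! ### Admissible small lattices and the canonical projector -/

/-- **Admissibility** of the small lattice `L_a` for the average over `L_{a'}` against `ψ_b` at `v`: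
`L_a ≤ L_{a'}`, `L_a` fixes `v`, and `ψ_b` is trivial on `L_a`. [folklore] -/
structure IsAdm (ρ : Representation ℂ (GL (Fin n) F) V) (ψ : AddChar F Circle) (ϖ : F) (t : Fin n)
    (a' a : Fin n → ℤ) (b : Fin n → F) (v : V) : Prop where
  le : ∀ i, i < t → a' i ≤ a i
  fix : ∀ x ∈ colLat ϖ t a, ρ (colElem t x) v = v
  triv : ∀ i, i < t → b i ∈ zBall ϖ (-a i)

namespace IsAdm

variable {t : Fin n} {a' a a₂ : Fin n → ℤ} {b : Fin n → F} {v w : V}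

/-- Shrinking the small lattice preserves admissibility. [folklore] -/
theorem mono (h : IsAdm ρ ψ ϖ t a' a b v) (hϖ0 : ϖ ≠ 0) (hϖ1 : valuation F ϖ ≤ 1)
    (h2 : ∀ i, i < t → a i ≤ a₂ i) : IsAdm ρ ψ ϖ t a' a₂ b v where
  le i hi := (h.le i hi).trans (h2 i hi)
  fix x hx := h.fix x (colLat_mono hϖ0 hϖ1 h2 hx)
  triv i hi := zBall_anti hϖ0 hϖ1 (neg_le_neg (h2 i hi)) (h.triv i hi)

/-- Enlarging the big lattice (keeping it above the small one) preserves admissibility. [folklore] -/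
theorem of_le (h : IsAdm ρ ψ ϖ t a' a b v) {a'' : Fin n → ℤ} (h2 : ∀ i, i < t → a'' i ≤ a i) :
    IsAdm ρ ψ ϖ t a'' a b v where
  le := h2
  fix := h.fix
  triv := h.triv

/-- The quotient `L_{a'}/L_a` of an admissible pair is finite. [folklore] -/
theorem finite [Finite 𝓀[F]] (hϖ : IsUniformizingElement ϖ) (h : IsAdm ρ ψ ϖ t a' a b v) :
    Finite (LQ ϖ t a' a) :=
  finite_colLat_quotient hϖ t h.le

/-- Admissibility is stable under sums of vectors. [folklore] -/
theorem add (hv : IsAdm ρ ψ ϖ t a' a b v) (hw : IsAdm ρ ψ ϖ t a' a b w) : IsAdm ρ ψ ϖ t a' a b (v + w) where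
  le := hv.le
  fix x hx := by rw [map_add, hv.fix x hx, hw.fix x hx]
  triv := hv.triv

/-- Admissibility is stable under scalar multiples. [folklore] -/
theorem smul (hv : IsAdm ρ ψ ϖ t a' a b v) (c : ℂ) : IsAdm ρ ψ ϖ t a' a b (c • v) where
  le := hv.le
  fix x hx := by rw [map_smul, hv.fix x hx]
  triv := hv.triv

/-- Admissibility for `v` fixed by `L_a` passes to `ρ(c_t(y)) v`. [folklore] -/
theorem apply_colElem (hv : IsAdm ρ ψ ϖ t a' a b v) (y : Fin n → F) :
    IsAdm ρ ψ ϖ t a' a b (ρ (colElem t y) v) where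
  le := hv.le
  fix x hx := by rw [apply_colElem_comm, hv.fix x hx]
  triv := hv.triv

/-- **Independence of the admissible small lattice** for the normalised average. [folklore] -/
theorem twAvg_eq [Finite 𝓀[F]] (hϖ : IsUniformizingElement ϖ) (hψ : ∀ c ∈ 𝒪[F], ψ c = 1)
    (h : IsAdm ρ ψ ϖ t a' a b v) (h' : IsAdm ρ ψ ϖ t a' a₂ b v) :
    twAvg ρ ψ ϖ t a' a b v = twAvg ρ ψ ϖ t a' a₂ b v := by
  -- compare both with the common refinement `a ⊔ a₂`
  have hm : IsAdm ρ ψ ϖ t a' (a ⊔ a₂) b v := h.mono hϖ.ne_zero hϖ.valuation_le_one fun i _ => le_sup_left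
  haveI := h.finite hϖ
  haveI := h'.finite hϖ
  haveI := hm.finite hϖ
  rw [twAvg_eq_twAvg_of_le (a₂ := a ⊔ a₂) hψ hϖ.ne_zero hϖ.valuation_le_one (fun i _ => le_sup_left)
      h.fix h.triv,
    twAvg_eq_twAvg_of_le (a₂ := a ⊔ a₂) hψ hϖ.ne_zero hϖ.valuation_le_one (fun i _ => le_sup_right)
      h'.fix h'.triv]

end IsAdm

open Classical in
/-- The **canonical twisted projector** `e^{(t)}_{a',b} v = vol(L_{a'})⁻¹ ∫_{L_{a'}} ψ_b(x)⁻¹ ρ(c_t(x)) v dx`,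
computed on any admissible small lattice (junk value `0` if there is none, which does not happen
for smooth vectors). [folklore] -/
def proj (ρ : Representation ℂ (GL (Fin n) F) V) (ψ : AddChar F Circle) (ϖ : F) (t : Fin n)
    (a' : Fin n → ℤ) (b : Fin n → F) (v : V) : V :=
  if h : ∃ a, IsAdm ρ ψ ϖ t a' a b v then twAvg ρ ψ ϖ t a' h.choose b v else 0

/-- The projector is the normalised average over any admissible small lattice. [folklore] -/
theorem proj_eq_twAvg [Finite 𝓀[F]] (hϖ : IsUniformizingElement ϖ) (hψ : ∀ c ∈ 𝒪[F], ψ c = 1)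
    {t : Fin n} {a' a : Fin n → ℤ} {b : Fin n → F} {v : V} (h : IsAdm ρ ψ ϖ t a' a b v) :
    proj ρ ψ ϖ t a' b v = twAvg ρ ψ ϖ t a' a b v := by
  have hex : ∃ a, IsAdm ρ ψ ϖ t a' a b v := ⟨a, h⟩
  rw [proj, dif_pos hex]
  exact hex.choose_spec.twAvg_eq hϖ hψ h

/-- The projector as an explicit normalised sum over an admissible small lattice. [folklore] -/
theorem proj_eq_sum [Finite 𝓀[F]] (hϖ : IsUniformizingElement ϖ) (hψ : ∀ c ∈ 𝒪[F], ψ c = 1)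
    {t : Fin n} {a' a : Fin n → ℤ} {b : Fin n → F} {v : V} (h : IsAdm ρ ψ ϖ t a' a b v)
    [Fintype (LQ ϖ t a' a)] :
    proj ρ ψ ϖ t a' b v = ((Fintype.card (LQ ϖ t a' a) : ℂ))⁻¹ • ∑ q : LQ ϖ t a' a,
      cpair ψ b (-((q.out : colLat ϖ t a') : Fin n → F)) •
        ρ (colElem t ((q.out : colLat ϖ t a') : Fin n → F)) v := by
  rw [proj_eq_twAvg hϖ hψ h, twAvg, Nat.card_eq_fintype_card, twSum_eq_sum]

section Linear

variable [Finite 𝓀[F]] (hϖ : IsUniformizingElement ϖ) (hψ : ∀ c ∈ 𝒪[F], ψ c = 1)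
include hϖ hψ

/-- Additivity of the projector on vectors with admissible lattices. [folklore] -/
theorem proj_add {t : Fin n} {a' a₁ a₂ : Fin n → ℤ} {b : Fin n → F} {v w : V}
    (hv : IsAdm ρ ψ ϖ t a' a₁ b v) (hw : IsAdm ρ ψ ϖ t a' a₂ b w) :
    proj ρ ψ ϖ t a' b (v + w) = proj ρ ψ ϖ t a' b v + proj ρ ψ ϖ t a' b w := by
  have hv' : IsAdm ρ ψ ϖ t a' (a₁ ⊔ a₂) b v := hv.mono hϖ.ne_zero hϖ.valuation_le_one fun i _ => le_sup_left
  have hw' : IsAdm ρ ψ ϖ t a' (a₁ ⊔ a₂) b w := hw.mono hϖ.ne_zero hϖ.valuation_le_one fun i _ => le_sup_right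
  haveI := hv'.finite hϖ
  haveI : Fintype (LQ ϖ t a' (a₁ ⊔ a₂)) := Fintype.ofFinite _
  rw [proj_eq_twAvg hϖ hψ (hv'.add hw'), proj_eq_twAvg hϖ hψ hv', proj_eq_twAvg hϖ hψ hw', twAvg, twAvg,
    twAvg, twSum_add, smul_add]

/-- Homogeneity of the projector. [folklore] -/
theorem proj_smul {t : Fin n} {a' a : Fin n → ℤ} {b : Fin n → F} (c : ℂ) {v : V}
    (hv : IsAdm ρ ψ ϖ t a' a b v) : proj ρ ψ ϖ t a' b (c • v) = c • proj ρ ψ ϖ t a' b v := by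
  haveI := hv.finite hϖ
  haveI : Fintype (LQ ϖ t a' a) := Fintype.ofFinite _
  rw [proj_eq_twAvg hϖ hψ (hv.smul c), proj_eq_twAvg hϖ hψ hv, twAvg, twAvg, twSum_smul, smul_comm]

/-- **Equivariance of the projector**: `ρ(c_t(y)) e_{a',b} v = ψ_b(y) e_{a',b} v` for `y ∈ L_{a'}`.
[folklore] -/
theorem apply_colElem_proj {t : Fin n} {a' a : Fin n → ℤ} {b : Fin n → F} {v : V}
    (hv : IsAdm ρ ψ ϖ t a' a b v) {y : Fin n → F} (hy : y ∈ colLat ϖ t a') :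
    ρ (colElem t y) (proj ρ ψ ϖ t a' b v) = cpair ψ b y • proj ρ ψ ϖ t a' b v := by
  haveI := hv.finite hϖ
  haveI : Fintype (LQ ϖ t a' a) := Fintype.ofFinite _
  rw [proj_eq_twAvg hϖ hψ hv, twAvg, map_smul, apply_colElem_twSum hψ hϖ.ne_zero hv.fix hv.triv hy,
    smul_comm]

/-- **Projected vectors keep admissible lattices**: if `L_a` is admissible for `(L_{a'}, ψ_b, w)` then it
is admissible for `(L_{a₁'}, ψ_{b₁}, e_{a',b} w)` whenever `L_a ≤ L_{a₁'}` and `ψ_{b₁}` is trivial on `L_a`.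
[folklore] -/
theorem IsAdm.of_proj {t : Fin n} {a' a a₁' : Fin n → ℤ} {b b₁ : Fin n → F} {w : V}
    (hw : IsAdm ρ ψ ϖ t a' a b w) (hle : ∀ i, i < t → a₁' i ≤ a i)
    (hb₁ : ∀ i, i < t → b₁ i ∈ zBall ϖ (-a i)) : IsAdm ρ ψ ϖ t a₁' a b₁ (proj ρ ψ ϖ t a' b w) where
  le := hle
  fix x hx := by
    rw [apply_colElem_proj hϖ hψ hw (colLat_mono hϖ.ne_zero hϖ.valuation_le_one hw.le hx),
      cpair_eq_one_of_mem ψ hψ hϖ.ne_zero hw.triv hx, one_smul]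
  triv := hb₁

/-- Equivariance in the vector: `e_{a',b}(ρ(c_t(y)) v) = ψ_b(y) e_{a',b} v` for `y ∈ L_{a'}`. [folklore] -/
theorem proj_apply_colElem {t : Fin n} {a' a : Fin n → ℤ} {b : Fin n → F} {v : V}
    (hv : IsAdm ρ ψ ϖ t a' a b v) {y : Fin n → F} (hy : y ∈ colLat ϖ t a') :
    proj ρ ψ ϖ t a' b (ρ (colElem t y) v) = cpair ψ b y • proj ρ ψ ϖ t a' b v := by
  haveI := hv.finite hϖ
  haveI : Fintype (LQ ϖ t a' a) := Fintype.ofFinite _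
  rw [proj_eq_twAvg hϖ hψ (hv.apply_colElem y), proj_eq_twAvg hϖ hψ hv, twAvg, twAvg,
    twSum_apply_colElem hψ hϖ.ne_zero hv.fix hv.triv hy, smul_comm]

/-- **Projectors commute.** [folklore] -/
theorem proj_comm {t : Fin n} {a₁' a₁ a₂' a₂ : Fin n → ℤ} {b₁ b₂ : Fin n → F} {v : V}
    (h₁ : IsAdm ρ ψ ϖ t a₁' a₁ b₁ v) (h₂ : IsAdm ρ ψ ϖ t a₂' a₂ b₂ v)
    (h₁₂ : IsAdm ρ ψ ϖ t a₁' a₁ b₁ (proj ρ ψ ϖ t a₂' b₂ v))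
    (h₂₁ : IsAdm ρ ψ ϖ t a₂' a₂ b₂ (proj ρ ψ ϖ t a₁' b₁ v)) :
    proj ρ ψ ϖ t a₁' b₁ (proj ρ ψ ϖ t a₂' b₂ v) = proj ρ ψ ϖ t a₂' b₂ (proj ρ ψ ϖ t a₁' b₁ v) := by
  haveI := h₁.finite hϖ
  haveI := h₂.finite hϖ
  haveI : Fintype (LQ ϖ t a₁' a₁) := Fintype.ofFinite _
  haveI : Fintype (LQ ϖ t a₂' a₂) := Fintype.ofFinite _
  rw [proj_eq_twAvg hϖ hψ h₁₂, proj_eq_twAvg hϖ hψ h₂, proj_eq_twAvg hϖ hψ h₂₁, proj_eq_twAvg hϖ hψ h₁,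
    twAvg, twAvg, twAvg, twAvg, twSum_smul, twSum_smul, smul_comm, twSum_twSum_comm]

end Linear

section Algebra

variable [Finite 𝓀[F]] (hϖ : IsUniformizingElement ϖ) (hψ : ∀ c ∈ 𝒪[F], ψ c = 1)
include hϖ hψ

/-- **The projector on an equivariant vector, nested case**: if `ρ(c_t(y)) u = ψ_{b'}(y) u` on
`L_{a'}` and `ψ_{b'-b}` is trivial on `L_{a'}`, then `e_{a',b} u = u`. [folklore] -/
theorem proj_of_equivariant_eq_self {t : Fin n} {a' a : Fin n → ℤ} {b b' : Fin n → F} {u : V}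
    (h : IsAdm ρ ψ ϖ t a' a b u) (hu : ∀ y ∈ colLat ϖ t a', ρ (colElem t y) u = cpair ψ b' y • u)
    (hcond : ∀ i, i < t → (b' - b) i ∈ zBall ϖ (-a' i)) : proj ρ ψ ϖ t a' b u = u := by
  haveI := h.finite hϖ
  haveI : Fintype (LQ ϖ t a' a) := Fintype.ofFinite _
  rw [proj_eq_twAvg hϖ hψ h, twAvg, Nat.card_eq_fintype_card, twSum_of_equivariant hu, smul_smul,
    sum_cpair_out_eq_card ψ hψ hϖ.ne_zero hcond, inv_mul_cancel₀, one_smul]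
  rw [Nat.cast_ne_zero]; exact Fintype.card_ne_zero

/-- **The projector on an equivariant vector, disjoint case**: if `ρ(c_t(y)) u = ψ_{b'}(y) u` on
`L_{a'}`, `ψ_{b'}` is trivial on `L_a`, and `ψ_{b'-b}` is NOT trivial on `L_{a'}`, then `e_{a',b} u = 0`
(orthogonality of distinct characters of `L_{a'}/L_a`). [folklore] -/
theorem proj_of_equivariant_eq_zero (hψ' : ∃ c ∈ 𝒪[F], ψ (ϖ⁻¹ * c) ≠ 1) {t : Fin n}
    {a' a : Fin n → ℤ} {b b' : Fin n → F} {u : V} (h : IsAdm ρ ψ ϖ t a' a b u)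
    (hb' : ∀ i, i < t → b' i ∈ zBall ϖ (-a i))
    (hu : ∀ y ∈ colLat ϖ t a', ρ (colElem t y) u = cpair ψ b' y • u)
    (hcond : ¬ ∀ i, i < t → (b' - b) i ∈ zBall ϖ (-a' i)) : proj ρ ψ ϖ t a' b u = 0 := by
  haveI := h.finite hϖ
  haveI : Fintype (LQ ϖ t a' a) := Fintype.ofFinite _
  have hc : ∀ i, i < t → (b' - b) i ∈ zBall ϖ (-a i) := fun i hi =>
    (zBall ϖ (-a i)).sub_mem (hb' i hi) (h.triv i hi)
  rw [proj_eq_twAvg hϖ hψ h, twAvg, Nat.card_eq_fintype_card, twSum_of_equivariant hu, smul_smul,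
    sum_cpair_out_eq_zero ψ hϖ hψ hψ' hc hcond, mul_zero, zero_smul]

/-- **Composition of projectors, nested supports** (`L_{a₁'} ≤ L_{a₂'}`, `ψ_{b₂-b₁}` trivial on
`L_{a₁'}`): `e_{a₁',b₁} e_{a₂',b₂} v = e_{a₂',b₂} v`; in particular the `e_{a',b}` are idempotent.
[folklore] -/
theorem proj_proj_eq_self {t : Fin n} {a₁' a₂' a : Fin n → ℤ} {b₁ b₂ : Fin n → F} {v : V}
    (h21 : ∀ i, i < t → a₂' i ≤ a₁' i) (h₂ : IsAdm ρ ψ ϖ t a₂' a b₂ v)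
    (h₁ : IsAdm ρ ψ ϖ t a₁' a b₁ (proj ρ ψ ϖ t a₂' b₂ v))
    (hcond : ∀ i, i < t → (b₂ - b₁) i ∈ zBall ϖ (-a₁' i)) :
    proj ρ ψ ϖ t a₁' b₁ (proj ρ ψ ϖ t a₂' b₂ v) = proj ρ ψ ϖ t a₂' b₂ v :=
  proj_of_equivariant_eq_self hϖ hψ h₁ (fun _ hy =>
    apply_colElem_proj hϖ hψ h₂ (colLat_mono hϖ.ne_zero hϖ.valuation_le_one h21 hy)) hcond

/-- **Composition of projectors, disjoint supports** (`L_{a₁'} ≤ L_{a₂'}`, `ψ_{b₂-b₁}` non-trivial on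
`L_{a₁'}`): `e_{a₁',b₁} e_{a₂',b₂} v = 0` — orthogonality of the projectors. [folklore] -/
theorem proj_proj_eq_zero (hψ' : ∃ c ∈ 𝒪[F], ψ (ϖ⁻¹ * c) ≠ 1) {t : Fin n} {a₁' a₂' a : Fin n → ℤ}
    {b₁ b₂ : Fin n → F} {v : V} (h21 : ∀ i, i < t → a₂' i ≤ a₁' i) (h₂ : IsAdm ρ ψ ϖ t a₂' a b₂ v)
    (h₁ : IsAdm ρ ψ ϖ t a₁' a b₁ (proj ρ ψ ϖ t a₂' b₂ v))
    (hcond : ¬ ∀ i, i < t → (b₂ - b₁) i ∈ zBall ϖ (-a₁' i)) :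
    proj ρ ψ ϖ t a₁' b₁ (proj ρ ψ ϖ t a₂' b₂ v) = 0 :=
  proj_of_equivariant_eq_zero hϖ hψ hψ' h₁ h₂.triv (fun _ hy =>
    apply_colElem_proj hϖ hψ h₂ (colLat_mono hϖ.ne_zero hϖ.valuation_le_one h21 hy)) hcond

/-- Idempotence: `e_{a',b} (e_{a',b} v) = e_{a',b} v`. [folklore] -/
theorem proj_idem {t : Fin n} {a' a : Fin n → ℤ} {b : Fin n → F} {v : V} (h : IsAdm ρ ψ ϖ t a' a b v)
    (h' : IsAdm ρ ψ ϖ t a' a b (proj ρ ψ ϖ t a' b v)) :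
    proj ρ ψ ϖ t a' b (proj ρ ψ ϖ t a' b v) = proj ρ ψ ϖ t a' b v :=
  proj_proj_eq_self hϖ hψ (fun _ _ => le_rfl) h h' fun i _ => by
    rw [sub_self]; exact AddSubgroup.zero_mem _

omit hψ in
/-- Multiplicativity of the index along `L_{a''} ≥ L_{a'} ≥ L_a`, with `[L_{a''} : L_{a'}]` written as the
index `[L_{a'}^∨ : L_{a''}^∨]` of the dual lattices `L_e^∨ = L_{-e}`:
`#(L_{a''}/L_a) = #(L_{-a'}/L_{-a''}) · #(L_{a'}/L_a)`. [folklore] -/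
theorem card_LQ_mul {t : Fin n} {a'' a' a : Fin n → ℤ} (h1 : ∀ i, i < t → a'' i ≤ a' i)
    (h2 : ∀ i, i < t → a' i ≤ a i)
    [Fintype (LQ ϖ t a'' a)] [Fintype (LQ ϖ t (-a') (-a''))] [Fintype (LQ ϖ t a' a)] :
    Fintype.card (LQ ϖ t a'' a) = Fintype.card (LQ ϖ t (-a') (-a'')) * Fintype.card (LQ ϖ t a' a) := by
  rw [← Nat.card_eq_fintype_card, ← Nat.card_eq_fintype_card, ← Nat.card_eq_fintype_card]
  rw [show Nat.card (LQ ϖ t a'' a) = Nat.card 𝓀[F] ^ ∑ i : {i : Fin n // i < t}, (a i - a'' i).toNat from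
      natCard_colLat_quotient hϖ t (fun i hi => (h1 i hi).trans (h2 i hi)),
    show Nat.card (LQ ϖ t (-a') (-a'')) = Nat.card 𝓀[F] ^ ∑ i : {i : Fin n // i < t}, ((-a'') i - (-a') i).toNat
      from natCard_colLat_quotient hϖ t (fun i hi => neg_le_neg (h1 i hi)),
    show Nat.card (LQ ϖ t a' a) = Nat.card 𝓀[F] ^ ∑ i : {i : Fin n // i < t}, (a i - a' i).toNat from
      natCard_colLat_quotient hϖ t h2,
    ← pow_add, ← Finset.sum_add_distrib]
  congr 1
  refine Finset.sum_congr rfl fun i _ => ?_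
  have := h1 i i.2; have := h2 i i.2
  simp only [Pi.neg_apply]
  omega

omit [Finite 𝓀[F]] hϖ hψ in
/-- Equality of classes in `L_{a'}/L_a`. [folklore] -/
theorem LQ_mk_eq_mk_iff {t : Fin n} {a' a : Fin n → ℤ} (z w : colLat ϖ t a') :
    (QuotientAddGroup.mk z : LQ ϖ t a' a) = QuotientAddGroup.mk w ↔
      (w : Fin n → F) - (z : Fin n → F) ∈ colLat ϖ t a := by
  rw [QuotientAddGroup.eq, AddSubgroup.mem_addSubgroupOf, AddSubgroup.coe_add, AddSubgroup.coe_neg,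
    neg_add_eq_sub]

omit [Finite 𝓀[F]] hϖ hψ in
/-- The chosen representative of a class differs from any representative by an element of `L_a`.
[folklore] -/
theorem LQ_out_sub_mem {t : Fin n} {a' a : Fin n → ℤ} (z : colLat ϖ t a') (q : LQ ϖ t a' a)
    (hq : (QuotientAddGroup.mk z : LQ ϖ t a' a) = q) :
    ((q.out : colLat ϖ t a') : Fin n → F) - (z : Fin n → F) ∈ colLat ϖ t a := by
  rw [← LQ_mk_eq_mk_iff, QuotientAddGroup.out_eq']; exact hq

/-- **Refinement of a projector into finer pieces**: for `L_{a''} ≥ L_{a'}` (`a'' ≤ a'`),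
`e_{a',b} v = ∑_{c ∈ L_{a'}^∨ / L_{a''}^∨} e_{a'',b+c} v` — the Fourier support `b + L_{a'}^∨` is the
disjoint union of the pieces `b + c + L_{a''}^∨` (finite Fourier inversion on `L_{a''}/L_{a'}`).
[folklore] -/
theorem proj_eq_sum_proj (hψ' : ∃ c ∈ 𝒪[F], ψ (ϖ⁻¹ * c) ≠ 1) {t : Fin n} {a'' a' a : Fin n → ℤ}
    {b : Fin n → F} {v : V} (h1 : ∀ i, i < t → a'' i ≤ a' i) (h : IsAdm ρ ψ ϖ t a' a b v)
    [Fintype (LQ ϖ t (-a') (-a''))] :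
    proj ρ ψ ϖ t a' b v = ∑ c : LQ ϖ t (-a') (-a''),
      proj ρ ψ ϖ t a'' (b + ((c.out : colLat ϖ t (-a')) : Fin n → F)) v := by
  classical
  have h'' : IsAdm ρ ψ ϖ t a'' a b v := h.of_le fun i hi => (h1 i hi).trans (h.le i hi)
  haveI := h.finite hϖ
  haveI := h''.finite hϖ
  haveI : Fintype (LQ ϖ t a' a) := Fintype.ofFinite _
  haveI : Fintype (LQ ϖ t a'' a) := Fintype.ofFinite _
  -- admissibility of `a` for the shifted characters
  have hbc : ∀ c : LQ ϖ t (-a') (-a''), IsAdm ρ ψ ϖ t a'' a (b + ((c.out : colLat ϖ t (-a')) : Fin n → F)) v := by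
    intro c
    refine ⟨h''.le, h''.fix, fun i hi => (zBall ϖ (-a i)).add_mem (h.triv i hi) ?_⟩
    exact zBall_anti hϖ.ne_zero hϖ.valuation_le_one (neg_le_neg (h.le i hi)) ((c.out).2.1 i hi)
  -- expand the right-hand side and exchange the sums
  have hR : ∀ c : LQ ϖ t (-a') (-a''), proj ρ ψ ϖ t a'' (b + ((c.out : colLat ϖ t (-a')) : Fin n → F)) v =
      ((Fintype.card (LQ ϖ t a'' a) : ℂ))⁻¹ • ∑ q : LQ ϖ t a'' a,
        (cpair ψ ((c.out : colLat ϖ t (-a')) : Fin n → F) (-((q.out : colLat ϖ t a'') : Fin n → F)) *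
          cpair ψ b (-((q.out : colLat ϖ t a'') : Fin n → F))) •
          ρ (colElem t ((q.out : colLat ϖ t a'') : Fin n → F)) v := by
    intro c
    rw [proj_eq_sum hϖ hψ (hbc c)]
    congr 1
    refine Finset.sum_congr rfl fun q _ => ?_
    rw [cpair_add_left, mul_comm]
  simp_rw [hR]
  rw [← Finset.smul_sum, Finset.sum_comm]
  simp_rw [← Finset.sum_smul, ← Finset.sum_mul]
  -- the inner character sum: `#(L_{a'}^∨/L_{a''}^∨)` if `q̃ ∈ L_{a'}`, else `0`
  have hinner : ∀ q : LQ ϖ t a'' a,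
      (∑ c : LQ ϖ t (-a') (-a''), cpair ψ ((c.out : colLat ϖ t (-a')) : Fin n → F)
        (-((q.out : colLat ϖ t a'') : Fin n → F))) =
      if ((q.out : colLat ϖ t a'') : Fin n → F) ∈ colLat ϖ t a' then
        (Fintype.card (LQ ϖ t (-a') (-a'')) : ℂ) else 0 := by
    intro q
    have hsymm : ∀ c : LQ ϖ t (-a') (-a''), cpair ψ ((c.out : colLat ϖ t (-a')) : Fin n → F)
        (-((q.out : colLat ϖ t a'') : Fin n → F)) =
        cpair ψ (-((q.out : colLat ϖ t a'') : Fin n → F)) ((c.out : colLat ϖ t (-a')) : Fin n → F) := by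
      intro c; rw [cpair, cpair, dotProduct_comm]
    simp_rw [hsymm]
    have hy : ∀ i, i < t → (-((q.out : colLat ϖ t a'') : Fin n → F)) i ∈ zBall ϖ (-(-a'') i) := by
      intro i hi
      rw [Pi.neg_apply, Pi.neg_apply, neg_neg]
      exact (zBall ϖ (a'' i)).neg_mem ((q.out).2.1 i hi)
    split_ifs with hq
    · refine sum_cpair_out_eq_card ψ hψ hϖ.ne_zero fun i hi => ?_
      rw [Pi.neg_apply, Pi.neg_apply, neg_neg]
      exact (zBall ϖ (a' i)).neg_mem (hq.1 i hi)
    · refine sum_cpair_out_eq_zero ψ hϖ hψ hψ' hy fun hq' => hq ⟨fun i hi => ?_, (q.out).2.2⟩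
      have := hq' i hi
      rw [Pi.neg_apply, Pi.neg_apply, neg_neg] at this
      simpa using (zBall ϖ (a' i)).neg_mem this
  simp_rw [hinner, ite_mul, zero_mul, ite_smul, zero_smul]
  rw [← Finset.sum_filter]
  -- the surviving classes are the image of `L_{a'}/L_a ↪ L_{a''}/L_a`
  set ι : LQ ϖ t a' a → LQ ϖ t a'' a := fun p =>
    QuotientAddGroup.mk (⟨((p.out : colLat ϖ t a') : Fin n → F),
      colLat_mono hϖ.ne_zero hϖ.valuation_le_one h1 (p.out).2⟩ : colLat ϖ t a'') with hι
  have hιinj : Function.Injective ι := by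
    intro p p' hpp'
    have := (LQ_mk_eq_mk_iff _ _).1 hpp'
    rw [← QuotientAddGroup.out_eq' p, ← QuotientAddGroup.out_eq' p', LQ_mk_eq_mk_iff]
    exact this
  have hfilter : Finset.univ.filter (fun q : LQ ϖ t a'' a =>
      ((q.out : colLat ϖ t a'') : Fin n → F) ∈ colLat ϖ t a') = Finset.univ.image ι := by
    ext q
    simp only [Finset.mem_filter, Finset.mem_univ, true_and, Finset.mem_image]
    constructor
    · intro hq
      refine ⟨QuotientAddGroup.mk ⟨_, hq⟩, ?_⟩
      conv_rhs => rw [← QuotientAddGroup.out_eq' q]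
      rw [hι, LQ_mk_eq_mk_iff]
      dsimp only
      -- `q̃ - [q̃]~ ∈ L_a`
      have := LQ_out_sub_mem (a := a) (⟨_, hq⟩ : colLat ϖ t a') _ rfl
      rw [← neg_mem_iff, neg_sub] at this
      exact this
    · rintro ⟨p, rfl⟩
      -- `(ι p)~ ≡ p̃ mod L_a`, and `p̃ ∈ L_{a'}`
      have h3 := LQ_out_sub_mem (a := a)
        (⟨((p.out : colLat ϖ t a') : Fin n → F), colLat_mono hϖ.ne_zero hϖ.valuation_le_one h1 (p.out).2⟩ :
          colLat ϖ t a'') (ι p) rfl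
      have h4 : ((p.out : colLat ϖ t a') : Fin n → F) ∈ colLat ϖ t a' := (p.out).2
      have := (colLat ϖ t a').add_mem (colLat_mono hϖ.ne_zero hϖ.valuation_le_one h.le h3) h4
      simpa using this
  rw [hfilter, Finset.sum_image fun p _ p' _ hpp' => hιinj hpp']
  -- evaluate the summands on the representatives `p̃` and recognise `#(L^∨-quotient) • S_{a'}(v)`
  have hsummand : ∀ p : LQ ϖ t a' a,
      ((Fintype.card (LQ ϖ t (-a') (-a'')) : ℂ) * cpair ψ b (-(((ι p).out : colLat ϖ t a'') : Fin n → F))) •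
        ρ (colElem t (((ι p).out : colLat ϖ t a'') : Fin n → F)) v =
      (Fintype.card (LQ ϖ t (-a') (-a'')) : ℂ) •
        (cpair ψ b (-((p.out : colLat ϖ t a') : Fin n → F)) • ρ (colElem t ((p.out : colLat ϖ t a') : Fin n → F)) v) := by
    intro p
    rw [mul_smul, summand_eq_of_mk_eq hψ hϖ.ne_zero h''.fix h''.triv
      (⟨((p.out : colLat ϖ t a') : Fin n → F), colLat_mono hϖ.ne_zero hϖ.valuation_le_one h1 (p.out).2⟩ :
        colLat ϖ t a'') (ι p) rfl]
  simp_rw [hsummand]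
  rw [← Finset.smul_sum, ← twSum_eq_sum, proj_eq_twAvg hϖ hψ h, twAvg, Nat.card_eq_fintype_card, smul_smul,
    card_LQ_mul hϖ h1 h.le, Nat.cast_mul]
  congr 1
  rw [mul_inv, mul_comm ((Fintype.card (LQ ϖ t (-a') (-a'')) : ℂ))⁻¹, mul_assoc, inv_mul_cancel₀, mul_one]
  rw [Nat.cast_ne_zero]; exact Fintype.card_ne_zero

end Algebra

/-! ### Conjugation, adjointness, Whittaker functionals -/

section Conjugation

omit [ValuativeRel F] in
/-- `ρ(g) ρ(c) v = ρ(g c g⁻¹) ρ(g) v`. [folklore] -/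
theorem apply_apply_eq_conj_apply (g c : GL (Fin n) F) (v : V) :
    ρ g (ρ c v) = ρ (g * c * g⁻¹) (ρ g v) := by
  rw [map_mul, map_mul, Module.End.mul_apply, Module.End.mul_apply, ρ.inv_self_apply]

/-- **Transport of structure for twisted sums.** If `g` conjugates `c_t(x)` to `c_t(φ x)` for an
additive `φ` carrying `(L_{a'}, L_a, ψ_b)` onto `(L_{a₂'}, L_{a₂}, ψ_{b₂})`, then
`ρ(g) S_{a',a,b}(v) = S_{a₂',a₂,b₂}(ρ(g) v)`. [folklore] -/
theorem apply_twSum_eq_twSum (hψ : ∀ c ∈ 𝒪[F], ψ c = 1) (hϖ0 : ϖ ≠ 0) (hϖ1 : valuation F ϖ ≤ 1)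
    (g : GL (Fin n) F) (φ : (Fin n → F) →+ (Fin n → F)) {t : Fin n}
    {a' a a₂' a₂ : Fin n → ℤ} {b b₂ : Fin n → F} {v : V}
    (hconj : ∀ x ∈ colLat ϖ t a', g * colElem t x * g⁻¹ = colElem t (φ x))
    (hchar : ∀ x ∈ colLat ϖ t a', cpair ψ b x = cpair ψ b₂ (φ x))
    (hmap' : ∀ x ∈ colLat ϖ t a', φ x ∈ colLat ϖ t a₂')
    (hsurj' : ∀ y ∈ colLat ϖ t a₂', ∃ x ∈ colLat ϖ t a', φ x = y)
    (hmap : ∀ x ∈ colLat ϖ t a, φ x ∈ colLat ϖ t a₂)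
    (hrefl : ∀ x ∈ colLat ϖ t a', φ x ∈ colLat ϖ t a₂ → x ∈ colLat ϖ t a)
    (hle₂ : ∀ i, i < t → a₂' i ≤ a₂ i)
    (hfix : ∀ x ∈ colLat ϖ t a, ρ (colElem t x) v = v)
    (hb₂ : ∀ i, i < t → b₂ i ∈ zBall ϖ (-a₂ i))
    [Fintype (LQ ϖ t a' a)] [Fintype (LQ ϖ t a₂' a₂)] :
    ρ g (twSum ρ ψ ϖ t a' a b v) = twSum ρ ψ ϖ t a₂' a₂ b₂ (ρ g v) := by
  -- the target vector is fixed by `L_{a₂}`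
  have hfix₂ : ∀ y ∈ colLat ϖ t a₂, ρ (colElem t y) (ρ g v) = ρ g v := by
    intro y hy
    obtain ⟨x, hx', rfl⟩ := hsurj' y (colLat_mono hϖ0 hϖ1 hle₂ hy)
    rw [← hconj x hx', ← apply_apply_eq_conj_apply, hfix x (hrefl x hx' hy)]
  -- the family of representatives `φ(q̃)` of `L_{a₂'}/L_{a₂}`
  set z : LQ ϖ t a' a → colLat ϖ t a₂' := fun q => ⟨φ ((q.out : colLat ϖ t a') : Fin n → F), hmap' _ (q.out).2⟩
    with hz
  have hbij : Function.Bijective fun q => (QuotientAddGroup.mk (z q) : LQ ϖ t a₂' a₂) := by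
    constructor
    · intro p p' hpp'
      have h1 := (LQ_mk_eq_mk_iff _ _).1 hpp'
      simp only [hz] at h1
      rw [← map_sub] at h1
      have h2 := hrefl _ ((colLat ϖ t a').sub_mem (p'.out).2 (p.out).2) h1
      rw [← QuotientAddGroup.out_eq' p, ← QuotientAddGroup.out_eq' p', LQ_mk_eq_mk_iff]
      exact h2
    · intro w
      obtain ⟨x, hx', hxw⟩ := hsurj' _ (w.out).2
      refine ⟨QuotientAddGroup.mk ⟨x, hx'⟩, ?_⟩
      dsimp only
      conv_rhs => rw [← QuotientAddGroup.out_eq' w]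
      rw [LQ_mk_eq_mk_iff]
      simp only [hz]
      rw [← hxw, ← map_sub]
      refine hmap _ ?_
      have := LQ_out_sub_mem (a := a) (⟨x, hx'⟩ : colLat ϖ t a') _ rfl
      rw [← neg_mem_iff, neg_sub] at this
      exact this
  rw [twSum_eq_sum_of_bijective hψ hϖ0 hfix₂ hb₂ z hbij, twSum_eq_sum, map_sum]
  refine Finset.sum_congr rfl fun q _ => ?_
  rw [map_smul, apply_apply_eq_conj_apply, hconj _ (q.out).2, hchar _ ((colLat ϖ t a').neg_mem (q.out).2),
    map_neg]

/-- **Conjugation by the torus**: `ρ(ϖ^c) S^{(t)}_{a',a,b}(v) = S^{(t)}_{d+a',d+a,b'}(ρ(ϖ^c) v)` with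
`d_i = c_i - c_t` and `b'_i = b_i ϖ^{-d_i}`. [folklore] -/
theorem apply_zpowDiagGL_twSum (hψ : ∀ c ∈ 𝒪[F], ψ c = 1) (hϖ0 : ϖ ≠ 0) (hϖ1 : valuation F ϖ ≤ 1)
    (c : Fin n → ℤ) {t : Fin n} {a' a : Fin n → ℤ} {b : Fin n → F} {v : V}
    (hle : ∀ i, i < t → a' i ≤ a i)
    (hfix : ∀ x ∈ colLat ϖ t a, ρ (colElem t x) v = v) (hb : ∀ i, i < t → b i ∈ zBall ϖ (-a i))
    [Fintype (LQ ϖ t a' a)]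
    [Fintype (LQ ϖ t (fun i => (c i - c t) + a' i) (fun i => (c i - c t) + a i))] :
    ρ (zpowDiagGL hϖ0 c) (twSum ρ ψ ϖ t a' a b v) =
      twSum ρ ψ ϖ t (fun i => (c i - c t) + a' i) (fun i => (c i - c t) + a i)
        (fun i => b i * ϖ ^ (-(c i - c t))) (ρ (zpowDiagGL hϖ0 c) v) := by
  set φ : (Fin n → F) →+ (Fin n → F) :=
    { toFun := fun x i => ϖ ^ (c i - c t) * x i
      map_zero' := by funext i; simp
      map_add' := fun x y => by funext i; simp [mul_add] } with hφ
  have hφapp : ∀ x, φ x = fun i => ϖ ^ (c i - c t) * x i := fun x => rfl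
  have hchar : ∀ x : Fin n → F, cpair ψ b x = cpair ψ (fun i => b i * ϖ ^ (-(c i - c t))) (φ x) := by
    intro x
    rw [hφapp, cpair_mul_eq]
    congr 1
    funext i
    rw [mul_assoc, ← zpow_add₀ hϖ0, neg_add_cancel, zpow_zero, mul_one]
  have hmem : ∀ (e : Fin n → ℤ) (x : Fin n → F), φ x ∈ colLat ϖ t (fun i => (c i - c t) + e i) ↔ x ∈ colLat ϖ t e :=
    fun e x => by rw [hφapp]; exact smul_mem_colLat_iff hϖ0 (fun i => c i - c t) e x
  refine apply_twSum_eq_twSum hψ hϖ0 hϖ1 _ φ (fun x _ => by rw [zpowDiagGL_mul_colElem_mul_inv]; rfl)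
    (fun x _ => hchar x) (fun x hx => (hmem a' x).2 hx) (fun y hy => ?_) (fun x hx => (hmem a x).2 hx)
    (fun x _ hx => (hmem a x).1 hx) (fun i hi => by have := hle i hi; omega) hfix
    (fun i hi => ?_)
  · -- surjectivity onto the scaled lattice
    refine ⟨fun i => ϖ ^ (-(c i - c t)) * y i, ?_, ?_⟩
    · rw [← hmem, hφapp]
      convert hy using 1
      funext i
      rw [← mul_assoc, ← zpow_add₀ hϖ0, add_neg_cancel, zpow_zero, one_mul]
    · rw [hφapp]
      funext i
      rw [← mul_assoc, ← zpow_add₀ hϖ0, add_neg_cancel, zpow_zero, one_mul]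
  · -- the new character is trivial on the new small lattice
    rw [neg_add, mul_comm]
    exact (zpow_mul_mem_zBall_iff hϖ0 _ _ _).2 (hb i hi)

/-- **Conjugation by an integral top-left element**: for `k ∈ GL_n(𝒪)` of shape `diag(k₀, 1_{n-t})`
and square lattices `L_{N'} ≥ L_N`, `ρ(k) S_{N',N,b}(v) = S_{N',N,b k⁻¹}(ρ(k) v)`. [folklore] -/
theorem apply_glInt_twSum (hψ : ∀ c ∈ 𝒪[F], ψ c = 1) (hϖ0 : ϖ ≠ 0) (hϖ1 : valuation F ϖ ≤ 1)
    {k : GL (Fin n) F} (hk : k ∈ glInt n F) {t : Fin n} (ht : IsTopLeft t (k : Matrix (Fin n) (Fin n) F))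
    {N' N : ℤ} (hN : ∀ i, i < t → N' ≤ N) {b : Fin n → F} {v : V}
    (hfix : ∀ x ∈ colLat ϖ t (fun _ => N), ρ (colElem t x) v = v)
    (hb : ∀ i, i < t → b i ∈ zBall ϖ (-N))
    [Fintype (LQ ϖ t (fun _ => N') (fun _ => N))] :
    ρ k (twSum ρ ψ ϖ t (fun _ => N') (fun _ => N) b v) =
      twSum ρ ψ ϖ t (fun _ => N') (fun _ => N) (b ᵥ* ((k⁻¹ : GL (Fin n) F) : Matrix (Fin n) (Fin n) F))
        (ρ k v) := by
  have hk' : k⁻¹ ∈ glInt n F := (glInt n F).inv_mem hk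
  have ht' : IsTopLeft t ((k⁻¹ : GL (Fin n) F) : Matrix (Fin n) (Fin n) F) := IsTopLeft.inv ht
  set φ : (Fin n → F) →+ (Fin n → F) := ((k : Matrix (Fin n) (Fin n) F).mulVecLin).toAddMonoidHom with hφ
  have hφapp : ∀ x, φ x = (k : Matrix (Fin n) (Fin n) F) *ᵥ x := fun x => rfl
  have hkk : ((k⁻¹ : GL (Fin n) F) : Matrix (Fin n) (Fin n) F) * (k : Matrix (Fin n) (Fin n) F) = 1 := by
    rw [← Units.val_mul, inv_mul_cancel, Units.val_one]
  have hkk' : (k : Matrix (Fin n) (Fin n) F) * ((k⁻¹ : GL (Fin n) F) : Matrix (Fin n) (Fin n) F) = 1 := by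
    rw [← Units.val_mul, mul_inv_cancel, Units.val_one]
  refine apply_twSum_eq_twSum hψ hϖ0 hϖ1 k φ (fun x hx => ?_) (fun x _ => ?_)
    (fun x hx => mulVec_mem_colLat_of_mem_glInt hk ht hx) (fun y hy => ?_)
    (fun x hx => mulVec_mem_colLat_of_mem_glInt hk ht hx) (fun x _ hx => ?_) hN hfix
    (fun i hi => ?_)
  · rw [topLeft_mul_colElem_mul_inv ht, trunc_eq_self_of_mem_colLat hx]; rfl
  · rw [hφapp, cpair_mulVec, Matrix.vecMul_vecMul, hkk, Matrix.vecMul_one]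
  · refine ⟨((k⁻¹ : GL (Fin n) F) : Matrix (Fin n) (Fin n) F) *ᵥ y, mulVec_mem_colLat_of_mem_glInt hk' ht' hy, ?_⟩
    rw [hφapp, Matrix.mulVec_mulVec, hkk', Matrix.one_mulVec]
  · have := mulVec_mem_colLat_of_mem_glInt hk' ht' hx
    rwa [hφapp, Matrix.mulVec_mulVec, hkk, Matrix.one_mulVec] at this
  · -- `b k⁻¹` is again in the dual box (square case): `(b k⁻¹)_i = ∑_j b_j (k⁻¹)_{ji}`
    rw [mem_zBall_iff, Matrix.vecMul, dotProduct]
    refine Valuation.map_sum_le _ fun j _ => ?_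
    rw [map_mul]
    by_cases hj : j < t
    · calc valuation F (b j) * valuation F (((k⁻¹ : GL (Fin n) F) : Matrix (Fin n) (Fin n) F) j i)
          ≤ valuation F (ϖ ^ (-N)) * 1 :=
            mul_le_mul' (mem_zBall_iff.1 (hb j hj)) ((Valuation.mem_integer_iff _ _).1
              (((mem_glInt_iff _).1 hk').1 j i))
        _ = valuation F (ϖ ^ (-N)) := mul_one _
    · have hji : j ≠ i := fun e => hj (e ▸ hi)
      rw [ht' j i (Or.inl (not_lt.1 hj)), if_neg hji, map_zero, mul_zero]
      exact zero_le

end Conjugation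

section ConjProj

variable [Finite 𝓀[F]] (hϖ : IsUniformizingElement ϖ) (hψ : ∀ c ∈ 𝒪[F], ψ c = 1)
include hϖ hψ

omit [Finite 𝓀[F]] hψ in
/-- Admissibility is transported by the torus. [folklore] -/
theorem IsAdm.conj_zpowDiagGL (c : Fin n → ℤ) {t : Fin n} {a' a : Fin n → ℤ} {b : Fin n → F} {v : V}
    (h : IsAdm ρ ψ ϖ t a' a b v) :
    IsAdm ρ ψ ϖ t (fun i => (c i - c t) + a' i) (fun i => (c i - c t) + a i)
      (fun i => b i * ϖ ^ (-(c i - c t))) (ρ (zpowDiagGL hϖ.ne_zero c) v) where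
  le i hi := by have := h.le i hi; omega
  fix y hy := by
    -- `y = φ x` with `x ∈ L_a`
    set x : Fin n → F := fun i => ϖ ^ (-(c i - c t)) * y i with hx
    have hyx : y = fun i => ϖ ^ (c i - c t) * x i := by
      funext i; rw [hx]; dsimp only
      rw [← mul_assoc, ← zpow_add₀ hϖ.ne_zero, add_neg_cancel, zpow_zero, one_mul]
    have hxmem : x ∈ colLat ϖ t a := by
      rw [← smul_mem_colLat_iff hϖ.ne_zero (fun i => c i - c t) a x, ← hyx]; exact hy
    rw [hyx, ← zpowDiagGL_mul_colElem_mul_inv hϖ.ne_zero c t x, ← apply_apply_eq_conj_apply, h.fix x hxmem]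
  triv i hi := by
    rw [neg_add, mul_comm]
    exact (zpow_mul_mem_zBall_iff hϖ.ne_zero _ _ _).2 (h.triv i hi)

/-- **The torus moves the projectors**: `ρ(ϖ^c) e^{(t)}_{a',b} v = e^{(t)}_{d+a',b'} ρ(ϖ^c) v`,
`d_i = c_i - c_t`, `b'_i = b_i ϖ^{-d_i}` (the lattice `L_{a'}` goes to `ϖ^d L_{a'}`, the character
`ψ_b` to `ψ_b ∘ Ad(ϖ^{-c})`). [folklore] -/
theorem apply_zpowDiagGL_proj (c : Fin n → ℤ) {t : Fin n} {a' a : Fin n → ℤ} {b : Fin n → F} {v : V}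
    (h : IsAdm ρ ψ ϖ t a' a b v) :
    ρ (zpowDiagGL hϖ.ne_zero c) (proj ρ ψ ϖ t a' b v) =
      proj ρ ψ ϖ t (fun i => (c i - c t) + a' i) (fun i => b i * ϖ ^ (-(c i - c t)))
        (ρ (zpowDiagGL hϖ.ne_zero c) v) := by
  have h2 := h.conj_zpowDiagGL hϖ c
  haveI := h.finite hϖ; haveI := h2.finite hϖ
  haveI : Fintype (LQ ϖ t a' a) := Fintype.ofFinite _
  haveI : Fintype (LQ ϖ t (fun i => (c i - c t) + a' i) (fun i => (c i - c t) + a i)) := Fintype.ofFinite _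
  rw [proj_eq_twAvg hϖ hψ h, proj_eq_twAvg hϖ hψ h2, twAvg, twAvg, map_smul,
    apply_zpowDiagGL_twSum hψ hϖ.ne_zero hϖ.valuation_le_one c h.le h.fix h.triv]
  have hcard : Nat.card (LQ ϖ t (fun i => (c i - c t) + a' i) (fun i => (c i - c t) + a i)) =
      Nat.card (LQ ϖ t a' a) := by
    rw [show Nat.card (LQ ϖ t (fun i => (c i - c t) + a' i) (fun i => (c i - c t) + a i)) = _ from
      natCard_colLat_quotient hϖ t h2.le, natCard_colLat_quotient hϖ t h.le]
    congr 1
    exact Finset.sum_congr rfl fun i _ => by congr 1; ring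
  rw [hcard]

omit [Finite 𝓀[F]] hϖ hψ in
/-- Admissibility is transported by integral top-left elements (square lattices). [folklore] -/
theorem IsAdm.conj_glInt {k : GL (Fin n) F} (hk : k ∈ glInt n F) {t : Fin n}
    (ht : IsTopLeft t (k : Matrix (Fin n) (Fin n) F)) {N' N : ℤ} {b : Fin n → F} {v : V}
    (h : IsAdm ρ ψ ϖ t (fun _ => N') (fun _ => N) b v) :
    IsAdm ρ ψ ϖ t (fun _ => N') (fun _ => N) (b ᵥ* ((k⁻¹ : GL (Fin n) F) : Matrix (Fin n) (Fin n) F)) (ρ k v) where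
  le := h.le
  fix y hy := by
    have hk' : k⁻¹ ∈ glInt n F := (glInt n F).inv_mem hk
    have hkk' : (k : Matrix (Fin n) (Fin n) F) * ((k⁻¹ : GL (Fin n) F) : Matrix (Fin n) (Fin n) F) = 1 := by
      rw [← Units.val_mul, mul_inv_cancel, Units.val_one]
    set x := ((k⁻¹ : GL (Fin n) F) : Matrix (Fin n) (Fin n) F) *ᵥ y with hx
    have hxmem : x ∈ colLat ϖ t (fun _ => N) := mulVec_mem_colLat_of_mem_glInt hk' (IsTopLeft.inv ht) hy
    have hyx : y = (k : Matrix (Fin n) (Fin n) F) *ᵥ trunc t x := by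
      rw [trunc_eq_self_of_mem_colLat hxmem, hx, Matrix.mulVec_mulVec, hkk', Matrix.one_mulVec]
    rw [hyx, ← topLeft_mul_colElem_mul_inv ht, ← apply_apply_eq_conj_apply, h.fix x hxmem]
  triv i hi := by
    have hk' : k⁻¹ ∈ glInt n F := (glInt n F).inv_mem hk
    have ht' := IsTopLeft.inv ht
    rw [mem_zBall_iff, Matrix.vecMul, dotProduct]
    refine Valuation.map_sum_le _ fun j _ => ?_
    rw [map_mul]
    by_cases hj : j < t
    · calc valuation F (b j) * valuation F (((k⁻¹ : GL (Fin n) F) : Matrix (Fin n) (Fin n) F) j i)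
          ≤ valuation F (ϖ ^ (-N)) * 1 :=
            mul_le_mul' (mem_zBall_iff.1 (h.triv j hj)) ((Valuation.mem_integer_iff _ _).1
              (((mem_glInt_iff _).1 hk').1 j i))
        _ = valuation F (ϖ ^ (-N)) := mul_one _
    · have hji : j ≠ i := fun e => hj (e ▸ hi)
      rw [ht' j i (Or.inl (not_lt.1 hj)), if_neg hji, map_zero, mul_zero]
      exact zero_le

/-- **`GL_t(𝒪)` moves the projectors of square lattices**: `ρ(k) e^{(t)}_{N',b} v = e^{(t)}_{N', b k⁻¹} ρ(k) v`
for `k ∈ GL_n(𝒪)` of shape `diag(k₀, 1)`. [folklore] -/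
theorem apply_glInt_proj {k : GL (Fin n) F} (hk : k ∈ glInt n F) {t : Fin n}
    (ht : IsTopLeft t (k : Matrix (Fin n) (Fin n) F)) {N' N : ℤ} {b : Fin n → F} {v : V}
    (h : IsAdm ρ ψ ϖ t (fun _ => N') (fun _ => N) b v) :
    ρ k (proj ρ ψ ϖ t (fun _ => N') b v) =
      proj ρ ψ ϖ t (fun _ => N') (b ᵥ* ((k⁻¹ : GL (Fin n) F) : Matrix (Fin n) (Fin n) F)) (ρ k v) := by
  have h2 := h.conj_glInt hk ht
  haveI := h.finite hϖ
  haveI : Fintype (LQ ϖ t (fun _ => N') (fun _ => N)) := Fintype.ofFinite _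
  rw [proj_eq_twAvg hϖ hψ h, proj_eq_twAvg hϖ hψ h2, twAvg, twAvg, map_smul,
    apply_glInt_twSum hψ hϖ.ne_zero hϖ.valuation_le_one hk ht h.le h.fix (fun i hi => h.triv i hi)]

end ConjProj

section Adjoint

variable [Finite 𝓀[F]] (hϖ : IsUniformizingElement ϖ) (hψ : ∀ c ∈ 𝒪[F], ψ c = 1)
include hϖ hψ

omit [Finite 𝓀[F]] hϖ in
/-- **Twisted sums are self-adjoint** for every Hermitian-style pairing invariant under the column
lattice: `Φ(S v, w) = Φ(v, S w)` for a sesquilinear `Φ` with `Φ(ρ(c_t x) v, ρ(c_t x) w) = Φ(v, w)`,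
`x ∈ L_{a'}` (both vectors fixed by `L_a`, `ψ_b` trivial on `L_a`). [folklore] -/
theorem form_twSum_left_eq_right (hϖ0 : ϖ ≠ 0) (Φ : V →ₗ⋆[ℂ] V →ₗ[ℂ] ℂ) {t : Fin n} {a' a : Fin n → ℤ}
    {b : Fin n → F} {v w : V}
    (hinv : ∀ x ∈ colLat ϖ t a', ∀ v' w' : V, Φ (ρ (colElem t x) v') (ρ (colElem t x) w') = Φ v' w')
    (hfixw : ∀ x ∈ colLat ϖ t a, ρ (colElem t x) w = w)
    (hb : ∀ i, i < t → b i ∈ zBall ϖ (-a i)) [Fintype (LQ ϖ t a' a)] :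
    Φ (twSum ρ ψ ϖ t a' a b v) w = Φ v (twSum ρ ψ ϖ t a' a b w) := by
  -- compute `S w` on the representatives `-q̃`
  have hbij : Function.Bijective fun q : LQ ϖ t a' a =>
      (QuotientAddGroup.mk (-(q.out : colLat ϖ t a')) : LQ ϖ t a' a) := by
    have : (fun q : LQ ϖ t a' a => (QuotientAddGroup.mk (-(q.out : colLat ϖ t a')) : LQ ϖ t a' a)) =
        Equiv.neg (LQ ϖ t a' a) := by
      funext q; rw [Equiv.neg_apply, QuotientAddGroup.mk_neg, QuotientAddGroup.out_eq']
    rw [this]; exact Equiv.bijective _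
  rw [twSum_eq_sum_of_bijective (v := w) hψ hϖ0 hfixw hb _ hbij, twSum_eq_sum, map_sum,
    LinearMap.sum_apply, map_sum]
  refine Finset.sum_congr rfl fun q _ => ?_
  rw [LinearMap.map_smulₛₗ₂, map_smul, AddSubgroup.coe_neg, neg_neg, smul_eq_mul, smul_eq_mul,
    starRingEnd_apply, ← starRingEnd_apply, conj_cpair, neg_neg]
  congr 1
  -- `Φ(ρ(c_t q̃) v, w) = Φ(v, ρ(c_t(-q̃)) w)`
  rw [← hinv (-((q.out : colLat ϖ t a') : Fin n → F)) ((colLat ϖ t a').neg_mem (q.out).2) (ρ (colElem t _) v) w,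
    ← apply_colElem_add, neg_add_cancel, colElem_zero, map_one, Module.End.one_apply]

/-- **Projectors are self-adjoint**: `Φ(e_{a',b} v, w) = Φ(v, e_{a',b} w)` for `Φ` sesquilinear and
invariant under `ρ(c_t(L_{a'}))`. [folklore] -/
theorem form_proj_left_eq_right (Φ : V →ₗ⋆[ℂ] V →ₗ[ℂ] ℂ) {t : Fin n} {a' a₁ a₂ : Fin n → ℤ}
    {b : Fin n → F} {v w : V}
    (hinv : ∀ x ∈ colLat ϖ t a', ∀ v' w' : V, Φ (ρ (colElem t x) v') (ρ (colElem t x) w') = Φ v' w')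
    (hv : IsAdm ρ ψ ϖ t a' a₁ b v) (hw : IsAdm ρ ψ ϖ t a' a₂ b w) :
    Φ (proj ρ ψ ϖ t a' b v) w = Φ v (proj ρ ψ ϖ t a' b w) := by
  have hv' : IsAdm ρ ψ ϖ t a' (a₁ ⊔ a₂) b v := hv.mono hϖ.ne_zero hϖ.valuation_le_one fun i _ => le_sup_left
  have hw' : IsAdm ρ ψ ϖ t a' (a₁ ⊔ a₂) b w := hw.mono hϖ.ne_zero hϖ.valuation_le_one fun i _ => le_sup_right
  haveI := hv'.finite hϖ
  haveI : Fintype (LQ ϖ t a' (a₁ ⊔ a₂)) := Fintype.ofFinite _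
  rw [proj_eq_twAvg hϖ hψ hv', proj_eq_twAvg hϖ hψ hw', twAvg, twAvg, LinearMap.map_smulₛₗ₂, map_smul,
    form_twSum_left_eq_right hψ hϖ.ne_zero Φ hinv hw'.fix hw'.triv, smul_eq_mul, smul_eq_mul]
  congr 1
  rw [starRingEnd_apply, star_inv₀, star_natCast]

omit [Finite 𝓀[F]] hϖ hψ in
/-- **Whittaker functionals see through the projectors at the standard character**: for a
`ψ`-Whittaker functional `Λ` and `b = e_{t-1}`, `Λ(S v) = [L_{a'} : L_a] Λ(v)`. [folklore] -/
theorem whittaker_twSum {t tp : Fin n} (htp : (tp : ℕ) + 1 = t) {a' a : Fin n → ℤ} {v : V}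
    {Λ : Module.Dual ℂ V} (hΛ : Λ ∈ whittakerFunctionals ρ ψ) [Fintype (LQ ϖ t a' a)] :
    Λ (twSum ρ ψ ϖ t a' a (Pi.single tp 1) v) = (Fintype.card (LQ ϖ t a' a) : ℂ) * Λ v := by
  rw [twSum_eq_sum, map_sum]
  have : ∀ q : LQ ϖ t a' a, Λ (cpair ψ (Pi.single tp 1) (-((q.out : colLat ϖ t a') : Fin n → F)) •
      ρ (colElem t ((q.out : colLat ϖ t a') : Fin n → F)) v) = Λ v := by
    intro q
    rw [map_smul, smul_eq_mul,
      show ρ (colElem t ((q.out : colLat ϖ t a') : Fin n → F)) v =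
        ρ ((⟨colElem t _, colElem_mem_upperUnitriangular t _⟩ : ↥(upperUnitriangular (Fin n) F)) :
          GL (Fin n) F) v from rfl,
      (mem_whittakerFunctionals_iff Λ).1 hΛ, whittakerCharFun_colElem ψ t tp htp, ← cpair_single_one,
      ← mul_assoc, cpair_neg_right_mul, one_mul]
  simp_rw [this]
  rw [Finset.sum_const, Finset.card_univ, nsmul_eq_mul]

/-- `Λ(e_{a', e_{t-1}} v) = Λ(v)` for a `ψ`-Whittaker functional `Λ`. [folklore] -/
theorem whittaker_proj {t tp : Fin n} (htp : (tp : ℕ) + 1 = t) {a' a : Fin n → ℤ} {v : V}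
    {Λ : Module.Dual ℂ V} (hΛ : Λ ∈ whittakerFunctionals ρ ψ) (hv : IsAdm ρ ψ ϖ t a' a (Pi.single tp 1) v) :
    Λ (proj ρ ψ ϖ t a' (Pi.single tp 1) v) = Λ v := by
  haveI := hv.finite hϖ
  haveI : Fintype (LQ ϖ t a' a) := Fintype.ofFinite _
  rw [proj_eq_twAvg hϖ hψ hv, twAvg, map_smul, whittaker_twSum htp hΛ, Nat.card_eq_fintype_card, smul_eq_mul,
    ← mul_assoc, inv_mul_cancel₀, one_mul]
  rw [Nat.cast_ne_zero]; exact Fintype.card_ne_zero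

end Adjoint

/-! ### Existence of admissible lattices for smooth vectors -/

section Existence

variable [TopologicalSpace F] [IsNonarchimedeanLocalField F]

omit [ValuativeRel F] in
/-- A coordinate of an integer vector is bounded by the sum of the absolute values. [folklore] -/
theorem le_sum_abs (f : Fin n → ℤ) (i : Fin n) : f i ≤ ∑ j, |f j| :=
  (le_abs_self _).trans (Finset.single_le_sum (fun j _ => abs_nonneg (f j)) (Finset.mem_univ i))

omit [ValuativeRel F] in
/-- Same for the negative. [folklore] -/
theorem neg_le_sum_abs (f : Fin n → ℤ) (i : Fin n) : -f i ≤ ∑ j, |f j| :=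
  (neg_le_abs _).trans (Finset.single_le_sum (fun j _ => abs_nonneg (f j)) (Finset.mem_univ i))

/-- **Smooth vectors have admissible lattices**: for a smooth vector `v` and a character parameter `b`,
every small enough square lattice `L_M` is admissible for every `L_{a'} ≥ L_M`. [folklore] -/
theorem exists_isAdm (hϖ : IsUniformizingElement ϖ) (t : Fin n) (b : Fin n → F) {v : V}
    (hv : ρ.IsSmoothVector v) :
    ∃ M₀ : ℤ, ∀ M, M₀ ≤ M → ∀ a' : Fin n → ℤ, (∀ i, i < t → a' i ≤ M) → IsAdm ρ ψ ϖ t a' (fun _ => M) b v := by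
  obtain ⟨k₁, hk₁⟩ := exists_colLat_colElem_mem hϖ hv t
  choose k₂ hk₂ using fun i => exists_forall_mem_zBall hϖ (b i)
  refine ⟨k₁ ⊔ (∑ j, |k₂ j|), fun M hM a' ha' => ⟨ha', fun x hx => ?_, fun i _ => ?_⟩⟩
  · have hx' : x ∈ colLat ϖ t (fun _ => k₁) :=
      colLat_mono hϖ.ne_zero hϖ.valuation_le_one (fun _ _ => le_sup_left.trans hM) hx
    exact (ρ.mem_stabilizerSubgroup _ _).1 (hk₁ x hx')
  · refine hk₂ i (-M) ?_
    have := neg_le_sum_abs k₂ i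
    have : (∑ j, |k₂ j|) ≤ M := le_sup_right.trans hM
    omega

/-- Two smooth vectors have a common admissible square lattice (any small enough one). [folklore] -/
theorem exists_isAdm₂ (hϖ : IsUniformizingElement ϖ) (t : Fin n) (b : Fin n → F)
    {v w : V} (hv : ρ.IsSmoothVector v) (hw : ρ.IsSmoothVector w) :
    ∃ M₀ : ℤ, ∀ M, M₀ ≤ M → ∀ a' : Fin n → ℤ, (∀ i, i < t → a' i ≤ M) →
      IsAdm ρ ψ ϖ t a' (fun _ => M) b v ∧ IsAdm ρ ψ ϖ t a' (fun _ => M) b w := by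
  obtain ⟨M₁, h₁⟩ := exists_isAdm (ψ := ψ) hϖ t b hv
  obtain ⟨M₂, h₂⟩ := exists_isAdm (ψ := ψ) hϖ t b hw
  exact ⟨max M₁ M₂, fun M hM a' ha' =>
    ⟨h₁ M ((le_max_left _ _).trans hM) a' ha', h₂ M ((le_max_right _ _).trans hM) a' ha'⟩⟩

end Existence

end TwSum

end WhittakerBessel

end Literature.NumberTheory.Automorphic
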